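import Literature.Probability.Entropy.StrongDataProcessing
import Mathlib.Analysis.Calculus.Deriv.MeanValue
import Mathlib.Analysis.SpecialFunctions.Log.Deriv
import Mathlib.InformationTheory.KullbackLeibler.ChainRule
import Mathlib.Probability.Kernel.Disintegration.StandardBorel
import HarnessLib

/-!
# Strong data-processing constants: proof of Polyanskiy–Wu 2017, Theorem 3 (`η_{χ²} = η_KL`)

Sibling proof file of `Literature/Probability/Entropy/StrongDataProcessing.lean`: it DISCHARGES the
named fact `PolyanskiyWu2017_thm3` stated there (`theorem PolyanskiyWu2017_thm3_holds`): for every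
Markov kernel `κ` between finite alphabets with the discrete σ-algebra the input-independent
contraction coefficients of `χ²` and of KL coincide, `etaChiSq κ = etaKL κ`
[cite: PolyanskiyWu2017, Thm 3] (first obtained by Ahlswede–Gács 1976 for finite alphabets).

Source: Y. Polyanskiy, Y. Wu, *Strong data-processing inequalities for channels and Bayesian
networks*, in: Convexity and Concentration, IMA Vol. Math. Appl. 161, Springer 2017, 211–249,
arXiv:1508.06025 — Theorem 3 and its appendix proof ("Proof of Theorem 3", with Theorem 2 /
Remark 7 for the lower bound and the [CRS94] integral representation (39) for the upper bound).
We follow that proof; the architecture is described in the section docstring below. Everything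
here is a `theorem` (no new definitions, no new named facts).

## Contents

* finite-alphabet closed forms: `lintegral_rnDeriv_fintype` (`∫ f(dP/dQ) dQ = ∑_b q_b f(p_b/q_b)`),
  `klDiv_eq_ofReal_sum`, `chiSqDiv_eq_ofReal_sum`; mixtures `tP + (1-t)Q` (`isProbabilityMeasure_mix`,
  `toReal_mix_apply`, `ac_mix_left`, `mix_ac_right`, `comp_mix`); `etaChiSq_le_of_forall`,
  `div_le_etaChiSq` (the `χ²` analogues of the `η_KL` API in the statement file);
* real-variable cores: `klSum_le_of_chiSqSum_mix_le` (integral representation, differentiated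
  form) and `chiSqSum_le_of_klSum_le` (local quadratic behaviour of KL);
* `etaKL_le_etaChiSq`, `etaChiSq_le_etaKL` (stated for `MeasurableSingletonClass` finite
  alphabets, slightly more general than the fact) and `PolyanskiyWu2017_thm3_holds`.

## References

* [PolyanskiyWu2017] as above (read: `lit read arxiv:1508.06025`, pages p0004 (Thm 2–3) and
  p0016 (appendix proofs)).
* R. Ahlswede, P. Gács, *Spreading of sets in product spaces and hypercontraction of the Markov
  operator*, Ann. Probab. 4 (1976) 925–939 ([AG76]).
* M.-D. Choi, M. B. Ruskai, E. Seneta, *Equivalence of certain entropy contraction coefficients*,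
  Linear Algebra Appl. 208/209 (1994) 29–36 ([CRS94]).
-/

noncomputable section

open _root_.MeasureTheory _root_.ProbabilityTheory _root_.InformationTheory
open scoped ENNReal ProbabilityTheory Topology

namespace Literature.Probability.Entropy

/-! ### Proof of Theorem 3: `η_{χ²} = η_KL` for channels between finite alphabets

[cite: PolyanskiyWu2017, Thm 3; proof in the appendix "Proof of Theorem 3" (arXiv v4 App. A.2)
and Remark 7]. Architecture of the printed proof and of this formalization (masses
`p_b = P{b}`, `q_b = Q{b}`, `φ = klFun`, i.e. `φ(x) = x log x + 1 - x`):

* `η_KL ≥ η_{χ²}` (PW17 Thm 2 / Remark 7: local quadratic behaviour of KL). For a pair `(P, Q)`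
  admissible for `χ²` put `P_ε = ε P + (1-ε) Q`; the KL strong data-processing inequality at
  `(P_ε, Q)` reads `K_out(ε) ≤ η_KL K_in(ε)` with `K(ε) = D(P_ε‖Q) = ∑_b q_b φ(1 + ε r_b)`,
  `r_b = p_b/q_b - 1`, and `K(0) = K'(0) = 0`, `K''(0) = ∑_b q_b r_b² = χ²(P‖Q)`
  ("`D(P_ε‖Q) = ε² χ²(P‖Q)/2 + o(ε²)`"). The second-order comparison at `ε = 0`
  (`chiSqSum_le_of_klSum_le`: mean value theorem plus the slope characterisation of the
  derivative of `η K_in' - K_out'` at `0`) gives `χ²(κP‖κQ) ≤ η_KL χ²(P‖Q)`.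
* `η_KL ≤ η_{χ²}` (PW17 following [CRS94]: the integral representation
  `D(P‖Q) = ∫₀¹ χ²(P‖Q_t) dt/(1-t)`, `Q_t = tP + (1-t)Q`, i.e. PW17 (39) after `t ↦ t/(1-t)`).
  We use it in differentiated form: the potential
  `F(t) = ∑_b (p_b log(t p_b + (1-t) q_b) - (p_b - q_b) t)` has `F'(t) = χ²(P‖Q_t)/(1-t)` on
  `(0,1)` and `F(1) - F(0) = D(P‖Q)`; the `χ²` inequality at `(P, Q_t)` and
  `κ ∘ (tP + (1-t)Q) = t κP + (1-t) κQ` make `η_{χ²} F_in - F_out` monotone on `[0,1]`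
  (`klSum_le_of_chiSqSum_mix_le`), whence `D(κP‖κQ) ≤ η_{χ²} D(P‖Q)`.
* Finite alphabets enter only through the closed forms `klDiv P Q = ofReal (∑_b q_b φ(p_b/q_b))`
  and `chiSqDiv P Q = ofReal (∑_b q_b (p_b/q_b - 1)²)` for `P ≪ Q` (`lintegral_rnDeriv_fintype`),
  under which both suprema range over pairs of mass vectors.
-/

section Thm3Calculus

open Real Set Filter

variable {ι ι' : Type*} [Fintype ι] [Fintype ι']

/-- Derivative of the affine interpolation `s ↦ s p + (1-s) q`. [folklore] -/
theorem hasDerivAt_mixCoord (p q t : ℝ) :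
    HasDerivAt (fun s : ℝ => s * p + (1 - s) * q) (p - q) t := by
  have h1 : HasDerivAt (fun s : ℝ => s * p) (1 * p) t := (hasDerivAt_id' t).mul_const p
  have h2 : HasDerivAt (fun s : ℝ => (1 - s) * q) ((0 - 1) * q) t :=
    ((hasDerivAt_const t (1 : ℝ)).sub (hasDerivAt_id' t)).mul_const q
  exact (h1.fun_add h2).congr_deriv (by ring)

/-- Derivative on `(0,1)` of one term `p log(t p + (1-t) q) - (p - q) t` of the potential `F`:
it is `(1-t)(p-q)²/(tp+(1-t)q)`, i.e. the `χ²(P‖Q_t)` integrand divided by `1-t`. [folklore] -/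
theorem hasDerivAt_klPotential_term {p q t : ℝ} (hp : 0 ≤ p) (hq : 0 ≤ q) (hac : q = 0 → p = 0)
    (ht0 : 0 < t) (ht1 : t < 1) :
    HasDerivAt (fun s : ℝ => p * log (s * p + (1 - s) * q) - (p - q) * s)
      ((1 - t) * (p - q) ^ 2 / (t * p + (1 - t) * q)) t := by
  by_cases hp0 : p = 0
  · subst hp0
    have e : (fun s : ℝ => (0 : ℝ) * log (s * 0 + (1 - s) * q) - (0 - q) * s) = fun s => q * s := by
      funext s; ring
    have hd : (1 - t) * (0 - q) ^ 2 / (t * 0 + (1 - t) * q) = q := by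
      by_cases hq0 : q = 0
      · simp [hq0]
      · have hne : t * 0 + (1 - t) * q ≠ 0 := by
          rw [mul_zero, zero_add]; exact mul_ne_zero (sub_pos.2 ht1).ne' hq0
        rw [div_eq_iff hne]; ring
    rw [e, hd]
    exact ((hasDerivAt_id' t).const_mul q).congr_deriv (mul_one q)
  · have hq0 : q ≠ 0 := fun h => hp0 (hac h)
    have hp' : 0 < p := lt_of_le_of_ne hp (Ne.symm hp0)
    have hq' : 0 < q := lt_of_le_of_ne hq (Ne.symm hq0)
    have hu : 0 < t * p + (1 - t) * q := by
      have := mul_pos ht0 hp'; have := mul_pos (sub_pos.2 ht1) hq'; linarith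
    have hu' : t * p + (1 - t) * q ≠ 0 := hu.ne'
    have h1 := ((hasDerivAt_mixCoord p q t).log hu').const_mul p
    have h2 := (hasDerivAt_id' t).const_mul (p - q)
    refine (h1.fun_sub h2).congr_deriv ?_
    rw [eq_div_iff hu', sub_mul, mul_one, mul_div_assoc', div_mul_cancel₀ _ hu']
    ring

/-- Continuity on `[0,1]` of one term of the potential `F`. [folklore] -/
theorem continuousOn_klPotential_term {p q : ℝ} (hp : 0 ≤ p) (hq : 0 ≤ q) (hac : q = 0 → p = 0) :
    ContinuousOn (fun s : ℝ => p * log (s * p + (1 - s) * q) - (p - q) * s) (Icc 0 1) := by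
  by_cases hp0 : p = 0
  · subst hp0
    have e : (fun s : ℝ => (0 : ℝ) * log (s * 0 + (1 - s) * q) - (0 - q) * s) = fun s => q * s := by
      funext s; ring
    rw [e]; fun_prop
  · have hq0 : q ≠ 0 := fun h => hp0 (hac h)
    have hp' : 0 < p := lt_of_le_of_ne hp (Ne.symm hp0)
    have hq' : 0 < q := lt_of_le_of_ne hq (Ne.symm hq0)
    have hu : ∀ s ∈ Icc (0 : ℝ) 1, s * p + (1 - s) * q ≠ 0 := by
      rintro s ⟨hs0, hs1⟩
      have : 0 < s * p + (1 - s) * q := by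
        rcases eq_or_lt_of_le hs0 with h | hs
        · rw [← h]; simpa using hq'
        · have := mul_pos hs hp'; have := mul_nonneg (sub_nonneg.2 hs1) hq'.le; linarith
      exact this.ne'
    have hlog : ContinuousOn (fun s : ℝ => log (s * p + (1 - s) * q)) (Icc 0 1) :=
      ContinuousOn.log (by fun_prop) hu
    exact (continuousOn_const.mul hlog).sub (by fun_prop)

/-- `F(1) - F(0) = D(P‖Q)` termwise: `p log p - (p - q) - p log q = q φ(p/q)`. [folklore] -/
theorem klPotential_term_one_sub_zero {p q : ℝ} (hac : q = 0 → p = 0) :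
    (p * log (1 * p + (1 - 1) * q) - (p - q) * 1) - (p * log (0 * p + (1 - 0) * q) - (p - q) * 0) =
      q * klFun (p / q) := by
  simp only [one_mul, sub_self, zero_mul, add_zero, mul_one, sub_zero, zero_add, mul_zero]
  by_cases hq0 : q = 0
  · have hp0 := hac hq0
    subst hq0; subst hp0; simp
  · by_cases hp0 : p = 0
    · subst hp0; simp [klFun_apply]
    · rw [klFun_apply, Real.log_div hp0 hq0]
      field_simp
      ring

/-- `χ²(P‖Q_t)` termwise equals `(1-t)` times the derivative of the potential term. [folklore] -/
theorem chiSq_term_mix (p q t : ℝ) :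
    (t * p + (1 - t) * q) * (p / (t * p + (1 - t) * q) - 1) ^ 2 =
      (1 - t) * ((1 - t) * (p - q) ^ 2 / (t * p + (1 - t) * q)) := by
  by_cases hu : t * p + (1 - t) * q = 0
  · rw [hu]; simp
  · field_simp
    ring

/-- **`η_KL ≤ η_{χ²}`, real-variable core** (PW17 App. A.2 after [CRS94], differentiated integral
representation): if `χ²(p'‖t p' + (1-t) q') ≤ η χ²(p‖t p + (1-t) q)` for all `t ∈ (0,1)` then
`D(p'‖q') ≤ η D(p‖q)` (all divergences in the `f`-divergence form `∑ q f(p/q)`).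
[cite: PolyanskiyWu2017, App. A "Proof of Theorem 3", eq. (39)] -/
theorem klSum_le_of_chiSqSum_mix_le (p q : ι → ℝ) (p' q' : ι' → ℝ)
    (hp : ∀ i, 0 ≤ p i) (hq : ∀ i, 0 ≤ q i) (hac : ∀ i, q i = 0 → p i = 0)
    (hp' : ∀ j, 0 ≤ p' j) (hq' : ∀ j, 0 ≤ q' j) (hac' : ∀ j, q' j = 0 → p' j = 0) {η : ℝ}
    (H : ∀ t : ℝ, 0 < t → t < 1 →
      ∑ j, (t * p' j + (1 - t) * q' j) * (p' j / (t * p' j + (1 - t) * q' j) - 1) ^ 2 ≤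
        η * ∑ i, (t * p i + (1 - t) * q i) * (p i / (t * p i + (1 - t) * q i) - 1) ^ 2) :
    ∑ j, q' j * klFun (p' j / q' j) ≤ η * ∑ i, q i * klFun (p i / q i) := by
  obtain ⟨Fi, hFi⟩ : ∃ F : ℝ → ℝ,
      F = fun s => ∑ i, (p i * log (s * p i + (1 - s) * q i) - (p i - q i) * s) := ⟨_, rfl⟩
  obtain ⟨Fo, hFo⟩ : ∃ F : ℝ → ℝ,
      F = fun s => ∑ j, (p' j * log (s * p' j + (1 - s) * q' j) - (p' j - q' j) * s) := ⟨_, rfl⟩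
  have hmono : MonotoneOn (fun s => η * Fi s - Fo s) (Icc 0 1) := by
    refine monotoneOn_of_hasDerivWithinAt_nonneg (convex_Icc 0 1)
      (f' := fun s => η * ∑ i, (1 - s) * (p i - q i) ^ 2 / (s * p i + (1 - s) * q i) -
        ∑ j, (1 - s) * (p' j - q' j) ^ 2 / (s * p' j + (1 - s) * q' j)) ?_ ?_ ?_
    · have hci : ContinuousOn Fi (Icc 0 1) := by
        rw [hFi]
        exact continuousOn_finsetSum _ fun i _ =>
          continuousOn_klPotential_term (hp i) (hq i) (hac i)
      have hco : ContinuousOn Fo (Icc 0 1) := by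
        rw [hFo]
        exact continuousOn_finsetSum _ fun j _ =>
          continuousOn_klPotential_term (hp' j) (hq' j) (hac' j)
      exact (continuousOn_const.mul hci).sub hco
    · intro s hs
      rw [interior_Icc] at hs
      have hdi : HasDerivAt Fi (∑ i, (1 - s) * (p i - q i) ^ 2 / (s * p i + (1 - s) * q i)) s := by
        rw [hFi]
        exact HasDerivAt.fun_sum fun i _ =>
          hasDerivAt_klPotential_term (hp i) (hq i) (hac i) hs.1 hs.2
      have hdo : HasDerivAt Fo
          (∑ j, (1 - s) * (p' j - q' j) ^ 2 / (s * p' j + (1 - s) * q' j)) s := by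
        rw [hFo]
        exact HasDerivAt.fun_sum fun j _ =>
          hasDerivAt_klPotential_term (hp' j) (hq' j) (hac' j) hs.1 hs.2
      exact ((hdi.const_mul η).sub hdo).hasDerivWithinAt
    · intro s hs
      rw [interior_Icc] at hs
      have h := H s hs.1 hs.2
      simp only [chiSq_term_mix, ← Finset.mul_sum] at h
      have h1s : 0 < 1 - s := sub_pos.2 hs.2
      have e : η * ((1 - s) * ∑ i, (1 - s) * (p i - q i) ^ 2 / (s * p i + (1 - s) * q i)) =
          (1 - s) * (η * ∑ i, (1 - s) * (p i - q i) ^ 2 / (s * p i + (1 - s) * q i)) := by ring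
      rw [e] at h
      exact sub_nonneg.2 (le_of_mul_le_mul_left h h1s)
  have h01 := hmono (left_mem_Icc.2 zero_le_one) (right_mem_Icc.2 zero_le_one) zero_le_one
  have hi : Fi 1 - Fi 0 = ∑ i, q i * klFun (p i / q i) := by
    simp only [hFi]
    rw [← Finset.sum_sub_distrib]
    exact Finset.sum_congr rfl fun i _ => klPotential_term_one_sub_zero (hac i)
  have ho : Fo 1 - Fo 0 = ∑ j, q' j * klFun (p' j / q' j) := by
    simp only [hFo]
    rw [← Finset.sum_sub_distrib]
    exact Finset.sum_congr rfl fun j _ => klPotential_term_one_sub_zero (hac' j)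
  rw [← hi, ← ho, mul_sub]
  simp only at h01
  linarith

/-- Derivative of `x ↦ q φ(1 + x r)` (`φ = klFun`). [folklore] -/
theorem hasDerivAt_mul_klFun_affine {r e : ℝ} (q : ℝ) (he : 0 < 1 + e * r) :
    HasDerivAt (fun x : ℝ => q * klFun (1 + x * r)) (q * (r * log (1 + e * r))) e := by
  have h1 : HasDerivAt (fun x : ℝ => 1 + x * r) r e := (hasDerivAt_mul_const r).const_add 1
  have h2 := (hasDerivAt_klFun he.ne').comp e h1
  exact (h2.const_mul q).congr_deriv (by ring)

/-- Derivative of `x ↦ q r log(1 + x r)`. [folklore] -/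
theorem hasDerivAt_mul_mul_log_affine {r e : ℝ} (q : ℝ) (he : 0 < 1 + e * r) :
    HasDerivAt (fun x : ℝ => q * (r * log (1 + x * r))) (q * (r * (r / (1 + e * r)))) e := by
  have h1 : HasDerivAt (fun x : ℝ => 1 + x * r) r e := (hasDerivAt_mul_const r).const_add 1
  exact ((h1.log he.ne').const_mul r).const_mul q

/-- **`η_{χ²} ≤ η_KL`, real-variable core** (PW17 Remark 7 / Thm 2, local quadratic behaviour
`D(εP + (1-ε)Q ‖ Q) = ε² χ²(P‖Q)/2 + o(ε²)`): with `r = p/q - 1`, if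
`∑ q' φ(1 + ε r') ≤ η ∑ q φ(1 + ε r)` for all `ε ∈ (0,1)` then `∑ q' r'² ≤ η ∑ q r²`.
[cite: PolyanskiyWu2017, App. A "Proof of Theorem 2" and Remark 7] -/
theorem chiSqSum_le_of_klSum_le (q r : ι → ℝ) (q' r' : ι' → ℝ)
    (hr : ∀ i, -1 ≤ r i) (hr' : ∀ j, -1 ≤ r' j) {η : ℝ}
    (H : ∀ e : ℝ, 0 < e → e < 1 →
      ∑ j, q' j * klFun (1 + e * r' j) ≤ η * ∑ i, q i * klFun (1 + e * r i)) :
    ∑ j, q' j * r' j ^ 2 ≤ η * ∑ i, q i * r i ^ 2 := by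
  have pos : ∀ {e s : ℝ}, 0 ≤ e → e < 1 → -1 ≤ s → 0 < 1 + e * s :=
    fun {e s} he0 he1 hs => by nlinarith
  obtain ⟨h, hh⟩ : ∃ h : ℝ → ℝ,
      h = fun e => η * ∑ i, q i * klFun (1 + e * r i) - ∑ j, q' j * klFun (1 + e * r' j) :=
    ⟨_, rfl⟩
  obtain ⟨h1, hh1⟩ : ∃ h1 : ℝ → ℝ, h1 = fun e =>
      η * ∑ i, q i * (r i * log (1 + e * r i)) - ∑ j, q' j * (r' j * log (1 + e * r' j)) :=
    ⟨_, rfl⟩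
  have hder : ∀ e, 0 ≤ e → e < 1 → HasDerivAt h (h1 e) e := fun e he0 he1 => by
    rw [hh, hh1]
    exact ((HasDerivAt.fun_sum fun i _ =>
      hasDerivAt_mul_klFun_affine (q i) (pos he0 he1 (hr i))).const_mul η).fun_sub
      (HasDerivAt.fun_sum fun j _ => hasDerivAt_mul_klFun_affine (q' j) (pos he0 he1 (hr' j)))
  have hder1 : HasDerivAt h1 (η * ∑ i, q i * r i ^ 2 - ∑ j, q' j * r' j ^ 2) 0 := by
    rw [hh1]
    refine (((HasDerivAt.fun_sum fun i (_ : i ∈ Finset.univ) =>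
      hasDerivAt_mul_mul_log_affine (q i) (r := r i) (e := 0) (by norm_num)).const_mul η).fun_sub
      (HasDerivAt.fun_sum fun j (_ : j ∈ Finset.univ) =>
        hasDerivAt_mul_mul_log_affine (q' j) (r := r' j) (e := 0) (by norm_num))).congr_deriv ?_
    simp [sq]
  have h0 : h 0 = 0 := by rw [hh]; simp [klFun_one]
  have h10 : h1 0 = 0 := by rw [hh1]; simp
  by_contra hcon
  have hLneg : η * ∑ i, q i * r i ^ 2 - ∑ j, q' j * r' j ^ 2 < 0 := by linarith [not_le.1 hcon]
  have hev : ∀ᶠ z in 𝓝[>] (0 : ℝ),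
      slope h1 0 z < (η * ∑ i, q i * r i ^ 2 - ∑ j, q' j * r' j ^ 2) / 2 :=
    (hder1.hasDerivWithinAt (s := Ioi 0)).limsup_slope_le' Set.self_notMem_Ioi (by linarith)
  obtain ⟨u, hu0, hu⟩ := mem_nhdsGT_iff_exists_Ioo_subset.1 hev
  have hu0' : (0 : ℝ) < u := hu0
  set δ : ℝ := min (u / 2) (1 / 2) with hδ
  have hδ0 : 0 < δ := lt_min (half_pos hu0') (by norm_num)
  have hδu : δ < u := (min_le_left _ _).trans_lt (half_lt_self hu0')
  have hδ1 : δ < 1 := (min_le_right _ _).trans_lt (by norm_num)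
  have hcont : ContinuousOn h (Icc 0 δ) := fun x hx =>
    (hder x hx.1 (hx.2.trans_lt hδ1)).continuousAt.continuousWithinAt
  obtain ⟨c, hc, hceq⟩ := exists_hasDerivAt_eq_slope h h1 hδ0 hcont
    (fun x hx => hder x hx.1.le (hx.2.trans hδ1))
  have hc1 := hu ⟨hc.1, hc.2.trans hδu⟩
  simp only [Set.mem_setOf_eq, slope_def_field, h10, sub_zero] at hc1
  have hh1c : h1 c < 0 := by
    have h' := (div_lt_iff₀ hc.1).1 hc1
    have : (η * ∑ i, q i * r i ^ 2 - ∑ j, q' j * r' j ^ 2) / 2 * c < 0 :=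
      mul_neg_of_neg_of_pos (by linarith) hc.1
    linarith
  have hpos : 0 ≤ (h δ - h 0) / (δ - 0) := by
    rw [h0, sub_zero, sub_zero]
    refine div_nonneg ?_ hδ0.le
    rw [hh]
    exact sub_nonneg.2 (H δ hδ0 hδ1)
  rw [← hceq] at hpos
  exact absurd hpos (not_le.2 hh1c)

/-- Rewriting the masses of `εP + (1-ε)Q` relative to `Q` as `1 + ε r`, `r = p/q - 1`. [folklore] -/
theorem mul_klFun_mix_div (p q e : ℝ) :
    q * klFun ((e * p + (1 - e) * q) / q) = q * klFun (1 + e * (p / q - 1)) := by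
  by_cases hq : q = 0
  · simp [hq]
  · rw [show (e * p + (1 - e) * q) / q = 1 + e * (p / q - 1) by field_simp; ring]

end Thm3Calculus

section Thm3FiniteAlphabet

variable {B C : Type*} [MeasurableSpace B] [MeasurableSpace C]

/-- A ratio bound for every admissible pair bounds `η_{χ²}`. [folklore] -/
theorem etaChiSq_le_of_forall (κ : Kernel B C) {c : ℝ≥0∞}
    (h : ∀ (P Q : Measure B), IsProbabilityMeasure P → IsProbabilityMeasure Q →
      chiSqDiv P Q ≠ 0 → chiSqDiv P Q ≠ ∞ → chiSqDiv (κ ∘ₘ P) (κ ∘ₘ Q) / chiSqDiv P Q ≤ c) :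
    etaChiSq κ ≤ c :=
  iSup_le fun P => iSup_le fun Q => iSup_le fun hP => iSup_le fun hQ =>
    iSup_le fun h0 => iSup_le fun htop => h P Q hP hQ h0 htop

/-- Every admissible ratio is bounded by `η_{χ²}`. [cite: PolyanskiyWu2017, §2.1 eqs. (1)–(2)] -/
theorem div_le_etaChiSq (κ : Kernel B C) (P Q : Measure B) [IsProbabilityMeasure P]
    [IsProbabilityMeasure Q] (h0 : chiSqDiv P Q ≠ 0) (htop : chiSqDiv P Q ≠ ∞) :
    chiSqDiv (κ ∘ₘ P) (κ ∘ₘ Q) / chiSqDiv P Q ≤ etaChiSq κ :=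
  le_iSup_of_le P <| le_iSup_of_le Q <| le_iSup_of_le ‹_› <| le_iSup_of_le ‹_› <|
    le_iSup_of_le h0 <| le_iSup_of_le htop le_rfl

/-- `χ² < ∞` forces absolute continuity (by definition). [folklore] -/
theorem ac_of_chiSqDiv_ne_top {μ ν : Measure C} (h : chiSqDiv μ ν ≠ ∞) : μ ≪ ν := by
  by_contra hac
  apply h
  unfold chiSqDiv
  exact if_neg hac

/-- The mixture `t P + (1-t) Q` of probability measures is a probability measure. [folklore] -/
theorem isProbabilityMeasure_mix (P Q : Measure C) [IsProbabilityMeasure P]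
    [IsProbabilityMeasure Q] {t : ℝ} (ht0 : 0 ≤ t) (ht1 : t ≤ 1) :
    IsProbabilityMeasure (ENNReal.ofReal t • P + ENNReal.ofReal (1 - t) • Q) := by
  constructor
  simp only [Measure.add_apply, Measure.smul_apply, smul_eq_mul, measure_univ, mul_one]
  rw [← ENNReal.ofReal_add ht0 (sub_nonneg.2 ht1)]
  simp

/-- Masses of the mixture `t P + (1-t) Q`. [folklore] -/
theorem toReal_mix_apply (P Q : Measure C) [IsFiniteMeasure P] [IsFiniteMeasure Q]
    {t : ℝ} (ht0 : 0 ≤ t) (ht1 : t ≤ 1) (s : Set C) :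
    ((ENNReal.ofReal t • P + ENNReal.ofReal (1 - t) • Q) s).toReal =
      t * (P s).toReal + (1 - t) * (Q s).toReal := by
  simp only [Measure.add_apply, Measure.smul_apply, smul_eq_mul]
  rw [ENNReal.toReal_add (ENNReal.mul_ne_top ENNReal.ofReal_ne_top (measure_ne_top P s))
    (ENNReal.mul_ne_top ENNReal.ofReal_ne_top (measure_ne_top Q s)), ENNReal.toReal_mul,
    ENNReal.toReal_mul, ENNReal.toReal_ofReal ht0, ENNReal.toReal_ofReal (sub_nonneg.2 ht1)]

/-- `P ≪ t P + (1-t) Q` for `t > 0`. [folklore] -/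
theorem ac_mix_left (P Q : Measure C) {t : ℝ} (ht : 0 < t) :
    P ≪ ENNReal.ofReal t • P + ENNReal.ofReal (1 - t) • Q := by
  refine Measure.AbsolutelyContinuous.mk fun s _ h0 => ?_
  simp only [Measure.add_apply, Measure.smul_apply, smul_eq_mul] at h0
  have h1 : ENNReal.ofReal t * P s = 0 := nonpos_iff_eq_zero.1 (le_self_add.trans h0.le)
  exact (mul_eq_zero.1 h1).resolve_left (ENNReal.ofReal_pos.2 ht).ne'

/-- `t P + (1-t) Q ≪ Q` when `P ≪ Q`. [folklore] -/
theorem mix_ac_right (P Q : Measure C) (hac : P ≪ Q) (a b : ℝ≥0∞) : a • P + b • Q ≪ Q := by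
  refine Measure.AbsolutelyContinuous.mk fun s _ h0 => ?_
  simp [Measure.add_apply, h0, hac h0]

/-- Channels act affinely: `κ ∘ (aP + bQ) = a κP + b κQ`. [folklore] -/
theorem comp_mix {D : Type*} [MeasurableSpace D] (κ : Kernel C D) (P Q : Measure C)
    (a b : ℝ≥0∞) : κ ∘ₘ (a • P + b • Q) = a • (κ ∘ₘ P) + b • (κ ∘ₘ Q) := by
  rw [Measure.comp_add, Measure.comp_smul, Measure.comp_smul]

variable [MeasurableSingletonClass B] [Fintype B]

/-- On a finite alphabet `P{b} = (dP/dQ)(b) · Q{b}` for `P ≪ Q`. [folklore] -/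
theorem apply_singleton_eq_rnDeriv_mul (P Q : Measure B) [IsFiniteMeasure P] [IsFiniteMeasure Q]
    (hac : P ≪ Q) (b : B) : P {b} = P.rnDeriv Q b * Q {b} := by
  conv_lhs => rw [← Measure.withDensity_rnDeriv_eq P Q hac]
  rw [withDensity_apply _ (measurableSet_singleton b), lintegral_singleton]

/-- Finite-alphabet closed form of an `f`-divergence integral `∫ f(dP/dQ) dQ = ∑_b q_b f(p_b/q_b)`
(`f ≥ 0`; terms with `q_b = 0` vanish on both sides). [folklore] -/
theorem lintegral_rnDeriv_fintype (P Q : Measure B) [IsFiniteMeasure P] [IsFiniteMeasure Q]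
    (hac : P ≪ Q) (f : ℝ → ℝ) (hf : ∀ x, 0 ≤ x → 0 ≤ f x) :
    ∫⁻ x, ENNReal.ofReal (f (P.rnDeriv Q x).toReal) ∂Q =
      ENNReal.ofReal (∑ b, (Q {b}).toReal * f ((P {b}).toReal / (Q {b}).toReal)) := by
  rw [lintegral_fintype, ENNReal.ofReal_sum_of_nonneg fun b _ =>
    mul_nonneg ENNReal.toReal_nonneg
      (hf _ (div_nonneg ENNReal.toReal_nonneg ENNReal.toReal_nonneg))]
  refine Finset.sum_congr rfl fun b _ => ?_
  have key := apply_singleton_eq_rnDeriv_mul P Q hac b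
  by_cases hQb : Q {b} = 0
  · simp [hQb]
  · have hr : P.rnDeriv Q b = P {b} / Q {b} := by
      rw [key, ENNReal.mul_div_cancel_right hQb (measure_ne_top Q _)]
    rw [hr, ENNReal.toReal_div, mul_comm (Q {b}).toReal,
      ENNReal.ofReal_mul (hf _ (div_nonneg ENNReal.toReal_nonneg ENNReal.toReal_nonneg)),
      ENNReal.ofReal_toReal (measure_ne_top Q _)]

/-- `D(P‖Q) = ∑_b q_b φ(p_b/q_b)` on a finite alphabet, `φ(x) = x log x + 1 - x`. [folklore] -/
theorem klDiv_eq_ofReal_sum (P Q : Measure B) [IsFiniteMeasure P] [IsFiniteMeasure Q]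
    (hac : P ≪ Q) :
    klDiv P Q = ENNReal.ofReal (∑ b, (Q {b}).toReal * klFun ((P {b}).toReal / (Q {b}).toReal)) := by
  rw [klDiv_eq_lintegral_klFun_of_ac hac]
  exact lintegral_rnDeriv_fintype P Q hac klFun fun x hx => klFun_nonneg hx

/-- `χ²(P‖Q) = ∑_b q_b (p_b/q_b - 1)²` on a finite alphabet. [folklore] -/
theorem chiSqDiv_eq_ofReal_sum (P Q : Measure B) [IsFiniteMeasure P] [IsFiniteMeasure Q]
    (hac : P ≪ Q) :
    chiSqDiv P Q =
      ENNReal.ofReal (∑ b, (Q {b}).toReal * ((P {b}).toReal / (Q {b}).toReal - 1) ^ 2) := by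
  have h : chiSqDiv P Q = ∫⁻ x, ENNReal.ofReal (((P.rnDeriv Q x).toReal - 1) ^ 2) ∂Q := by
    unfold chiSqDiv
    exact if_pos hac
  rw [h]
  exact lintegral_rnDeriv_fintype P Q hac (fun x => (x - 1) ^ 2) fun x _ => sq_nonneg _

variable {A : Type*} [MeasurableSpace A] [MeasurableSingletonClass A] [Fintype A]

/-- **PW17 Theorem 3, first half: `η_KL ≤ η_{χ²}`** for a channel between finite alphabets.
[cite: PolyanskiyWu2017, Thm 3 with App. A "Proof of Theorem 3" (integral representation,
after [CRS94])] -/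
theorem etaKL_le_etaChiSq (κ : Kernel B A) [IsMarkovKernel κ] : etaKL κ ≤ etaChiSq κ := by
  refine etaKL_le_of_forall κ fun P Q hP hQ h0 htop => ?_
  by_cases hη : etaChiSq κ = ∞
  · rw [hη]; exact le_top
  have hac : P ≪ Q := (klDiv_ne_top_iff.1 htop).1
  obtain ⟨η, hη0, hηeq⟩ : ∃ η : ℝ, 0 ≤ η ∧ etaChiSq κ = ENNReal.ofReal η :=
    ⟨_, ENNReal.toReal_nonneg, (ENNReal.ofReal_toReal hη).symm⟩
  have hp : ∀ b, 0 ≤ (P {b}).toReal := fun _ => ENNReal.toReal_nonneg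
  have hq : ∀ b, 0 ≤ (Q {b}).toReal := fun _ => ENNReal.toReal_nonneg
  have hp' : ∀ a, 0 ≤ ((κ ∘ₘ P) {a}).toReal := fun _ => ENNReal.toReal_nonneg
  have hq' : ∀ a, 0 ≤ ((κ ∘ₘ Q) {a}).toReal := fun _ => ENNReal.toReal_nonneg
  have hac' : κ ∘ₘ P ≪ κ ∘ₘ Q := hac.comp_right κ
  have hacv : ∀ b, (Q {b}).toReal = 0 → (P {b}).toReal = 0 := fun b hb => by
    rcases (ENNReal.toReal_eq_zero_iff _).1 hb with hb | hb
    · simp [hac hb]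
    · exact absurd hb (measure_ne_top Q _)
  have hacv' : ∀ a, ((κ ∘ₘ Q) {a}).toReal = 0 → ((κ ∘ₘ P) {a}).toReal = 0 := fun a ha => by
    rcases (ENNReal.toReal_eq_zero_iff _).1 ha with ha | ha
    · simp [hac' ha]
    · exact absurd ha (measure_ne_top _ _)
  -- the `χ²` strong data-processing inequality along the segment `Q_t = tP + (1-t)Q`
  have H : ∀ t : ℝ, 0 < t → t < 1 →
      ∑ a, (t * ((κ ∘ₘ P) {a}).toReal + (1 - t) * ((κ ∘ₘ Q) {a}).toReal) *
          (((κ ∘ₘ P) {a}).toReal /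
            (t * ((κ ∘ₘ P) {a}).toReal + (1 - t) * ((κ ∘ₘ Q) {a}).toReal) - 1) ^ 2 ≤
        η * ∑ b, (t * (P {b}).toReal + (1 - t) * (Q {b}).toReal) *
          ((P {b}).toReal / (t * (P {b}).toReal + (1 - t) * (Q {b}).toReal) - 1) ^ 2 := by
    intro t ht0 ht1
    set M : Measure B := ENNReal.ofReal t • P + ENNReal.ofReal (1 - t) • Q with hM
    haveI : IsProbabilityMeasure M := isProbabilityMeasure_mix P Q ht0.le ht1.le
    have hPM : P ≪ M := ac_mix_left P Q ht0
    have hmass : ∀ b, (M {b}).toReal = t * (P {b}).toReal + (1 - t) * (Q {b}).toReal :=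
      fun b => toReal_mix_apply P Q ht0.le ht1.le {b}
    have hκM : κ ∘ₘ M = ENNReal.ofReal t • (κ ∘ₘ P) + ENNReal.ofReal (1 - t) • (κ ∘ₘ Q) :=
      comp_mix κ P Q _ _
    have hmass' : ∀ a, ((κ ∘ₘ M) {a}).toReal =
        t * ((κ ∘ₘ P) {a}).toReal + (1 - t) * ((κ ∘ₘ Q) {a}).toReal := fun a => by
      rw [hκM]; exact toReal_mix_apply _ _ ht0.le ht1.le {a}
    have hMtop : chiSqDiv P M ≠ ∞ := by
      rw [chiSqDiv_eq_ofReal_sum P M hPM]; exact ENNReal.ofReal_ne_top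
    have hM0 : chiSqDiv P M ≠ 0 := by
      intro h
      rw [chiSqDiv_eq_ofReal_sum P M hPM, ENNReal.ofReal_eq_zero] at h
      have hnn : ∀ b ∈ (Finset.univ : Finset B),
          0 ≤ (M {b}).toReal * ((P {b}).toReal / (M {b}).toReal - 1) ^ 2 :=
        fun b _ => mul_nonneg ENNReal.toReal_nonneg (sq_nonneg _)
      have hterm := (Finset.sum_eq_zero_iff_of_nonneg hnn).1 (le_antisymm h (Finset.sum_nonneg hnn))
      apply h0
      rw [klDiv_eq_zero_iff]
      refine Measure.ext_of_singleton fun b => ?_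
      rw [← ENNReal.toReal_eq_toReal_iff' (measure_ne_top P _) (measure_ne_top Q _)]
      have hb := hterm b (Finset.mem_univ b)
      rw [hmass b] at hb
      rcases mul_eq_zero.1 hb with hu | hsq
      · have h2 := (add_eq_zero_iff_of_nonneg (mul_nonneg ht0.le (hp b))
          (mul_nonneg (sub_pos.2 ht1).le (hq b))).1 hu
        have hp0 : (P {b}).toReal = 0 := (mul_eq_zero.1 h2.1).resolve_left ht0.ne'
        have hq0 : (Q {b}).toReal = 0 := (mul_eq_zero.1 h2.2).resolve_left (sub_pos.2 ht1).ne'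
        rw [hp0, hq0]
      · have hu : t * (P {b}).toReal + (1 - t) * (Q {b}).toReal ≠ 0 := by
          intro hu
          rw [hu, div_zero] at hsq
          norm_num at hsq
        have h2 : (P {b}).toReal / (t * (P {b}).toReal + (1 - t) * (Q {b}).toReal) - 1 = 0 :=
          pow_eq_zero_iff (n := 2) (by norm_num) |>.1 hsq
        rw [sub_eq_zero, div_eq_one_iff_eq hu] at h2
        have h3 : (1 - t) * ((P {b}).toReal - (Q {b}).toReal) = 0 := by linear_combination h2
        rcases mul_eq_zero.1 h3 with h4 | h4
        · exact absurd h4 (sub_pos.2 ht1).ne'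
        · linarith
    have h1 := div_le_etaChiSq κ P M hM0 hMtop
    rw [ENNReal.div_le_iff_le_mul (Or.inl hM0) (Or.inl hMtop), hηeq,
      chiSqDiv_eq_ofReal_sum _ _ (hPM.comp_right κ), chiSqDiv_eq_ofReal_sum P M hPM,
      ← ENNReal.ofReal_mul hη0, ENNReal.ofReal_le_ofReal_iff (mul_nonneg hη0
        (Finset.sum_nonneg fun b _ => mul_nonneg ENNReal.toReal_nonneg (sq_nonneg _)))] at h1
    simpa only [hmass, hmass'] using h1
  have key := klSum_le_of_chiSqSum_mix_le (fun b => (P {b}).toReal) (fun b => (Q {b}).toReal)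
    (fun a => ((κ ∘ₘ P) {a}).toReal) (fun a => ((κ ∘ₘ Q) {a}).toReal) hp hq hacv hp' hq' hacv' H
  refine ENNReal.div_le_of_le_mul ?_
  rw [hηeq, klDiv_eq_ofReal_sum _ _ hac', klDiv_eq_ofReal_sum P Q hac, ← ENNReal.ofReal_mul hη0]
  exact ENNReal.ofReal_le_ofReal key

/-- **PW17 Theorem 3, second half: `η_{χ²} ≤ η_KL`** for a channel between finite alphabets.
[cite: PolyanskiyWu2017, Thm 2 / Thm 3 with App. A Remark 7 (local quadratic behaviour)] -/
theorem etaChiSq_le_etaKL (κ : Kernel B A) [IsMarkovKernel κ] : etaChiSq κ ≤ etaKL κ := by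
  refine etaChiSq_le_of_forall κ fun P Q hP hQ h0 htop => ?_
  by_cases hη : etaKL κ = ∞
  · rw [hη]; exact le_top
  have hac : P ≪ Q := ac_of_chiSqDiv_ne_top htop
  obtain ⟨η, hη0, hηeq⟩ : ∃ η : ℝ, 0 ≤ η ∧ etaKL κ = ENNReal.ofReal η :=
    ⟨_, ENNReal.toReal_nonneg, (ENNReal.ofReal_toReal hη).symm⟩
  have hp : ∀ b, 0 ≤ (P {b}).toReal := fun _ => ENNReal.toReal_nonneg
  have hq : ∀ b, 0 ≤ (Q {b}).toReal := fun _ => ENNReal.toReal_nonneg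
  have hp' : ∀ a, 0 ≤ ((κ ∘ₘ P) {a}).toReal := fun _ => ENNReal.toReal_nonneg
  have hq' : ∀ a, 0 ≤ ((κ ∘ₘ Q) {a}).toReal := fun _ => ENNReal.toReal_nonneg
  have hac' : κ ∘ₘ P ≪ κ ∘ₘ Q := hac.comp_right κ
  -- the KL strong data-processing inequality along the segment `P_ε = εP + (1-ε)Q`
  have H : ∀ e : ℝ, 0 < e → e < 1 →
      ∑ a, ((κ ∘ₘ Q) {a}).toReal * klFun ((e * ((κ ∘ₘ P) {a}).toReal +
          (1 - e) * ((κ ∘ₘ Q) {a}).toReal) / ((κ ∘ₘ Q) {a}).toReal) ≤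
        η * ∑ b, (Q {b}).toReal *
          klFun ((e * (P {b}).toReal + (1 - e) * (Q {b}).toReal) / (Q {b}).toReal) := by
    intro e he0 he1
    set M : Measure B := ENNReal.ofReal e • P + ENNReal.ofReal (1 - e) • Q with hM
    haveI : IsProbabilityMeasure M := isProbabilityMeasure_mix P Q he0.le he1.le
    have hMQ : M ≪ Q := mix_ac_right P Q hac _ _
    have hmass : ∀ b, (M {b}).toReal = e * (P {b}).toReal + (1 - e) * (Q {b}).toReal :=
      fun b => toReal_mix_apply P Q he0.le he1.le {b}
    have hκM : κ ∘ₘ M = ENNReal.ofReal e • (κ ∘ₘ P) + ENNReal.ofReal (1 - e) • (κ ∘ₘ Q) :=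
      comp_mix κ P Q _ _
    have hmass' : ∀ a, ((κ ∘ₘ M) {a}).toReal =
        e * ((κ ∘ₘ P) {a}).toReal + (1 - e) * ((κ ∘ₘ Q) {a}).toReal := fun a => by
      rw [hκM]; exact toReal_mix_apply _ _ he0.le he1.le {a}
    have hMtop : klDiv M Q ≠ ∞ := by
      rw [klDiv_eq_ofReal_sum M Q hMQ]; exact ENNReal.ofReal_ne_top
    have hM0 : klDiv M Q ≠ 0 := by
      intro h
      rw [klDiv_eq_zero_iff] at h
      have hPQ : ∀ b, (P {b}).toReal = (Q {b}).toReal := fun b => by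
        have hb := hmass b
        rw [h] at hb
        have h3 : e * ((P {b}).toReal - (Q {b}).toReal) = 0 := by linear_combination -hb
        rcases mul_eq_zero.1 h3 with h4 | h4
        · exact absurd h4 he0.ne'
        · linarith
      apply h0
      have hsum : ∑ b, (Q {b}).toReal * ((P {b}).toReal / (Q {b}).toReal - 1) ^ 2 = 0 := by
        refine Finset.sum_eq_zero fun b _ => ?_
        rw [hPQ b]
        by_cases hq0 : (Q {b}).toReal = 0
        · simp [hq0]
        · rw [div_self hq0]; ring
      rw [chiSqDiv_eq_ofReal_sum P Q hac, hsum, ENNReal.ofReal_zero]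
    have h1 := div_le_etaKL κ M Q hM0 hMtop
    rw [ENNReal.div_le_iff_le_mul (Or.inl hM0) (Or.inl hMtop), hηeq,
      klDiv_eq_ofReal_sum _ _ (hMQ.comp_right κ), klDiv_eq_ofReal_sum M Q hMQ,
      ← ENNReal.ofReal_mul hη0, ENNReal.ofReal_le_ofReal_iff (mul_nonneg hη0
        (Finset.sum_nonneg fun b _ => mul_nonneg ENNReal.toReal_nonneg
          (klFun_nonneg (div_nonneg ENNReal.toReal_nonneg ENNReal.toReal_nonneg))))] at h1
    simpa only [hmass, hmass'] using h1
  have key := chiSqSum_le_of_klSum_le (fun b => (Q {b}).toReal)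
    (fun b => (P {b}).toReal / (Q {b}).toReal - 1) (fun a => ((κ ∘ₘ Q) {a}).toReal)
    (fun a => ((κ ∘ₘ P) {a}).toReal / ((κ ∘ₘ Q) {a}).toReal - 1)
    (fun b => by linarith [div_nonneg (hp b) (hq b)])
    (fun a => by linarith [div_nonneg (hp' a) (hq' a)]) (η := η) (fun e he0 he1 => by
      simpa only [mul_klFun_mix_div] using H e he0 he1)
  refine ENNReal.div_le_of_le_mul ?_
  rw [hηeq, chiSqDiv_eq_ofReal_sum _ _ hac', chiSqDiv_eq_ofReal_sum P Q hac,
    ← ENNReal.ofReal_mul hη0]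
  exact ENNReal.ofReal_le_ofReal key

end Thm3FiniteAlphabet

/-- **Polyanskiy–Wu 2017, Theorem 3 (Ahlswede–Gács 1976), PROVED for finite alphabets:**
`η_{χ²}(κ) = η_KL(κ)` for every Markov kernel between finite alphabets with the discrete
σ-algebra — discharge of the named fact `PolyanskiyWu2017_thm3`, following the printed proof
(App. A: local quadratic expansion for `≤`, the [CRS94] integral representation for `≥`).
[cite: PolyanskiyWu2017, Thm 3 and App. A "Proof of Theorem 3"] -/
theorem PolyanskiyWu2017_thm3_holds : PolyanskiyWu2017_thm3 := by
  intro A B _ _ _ _ _ _ κ hκ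
  exact le_antisymm (etaChiSq_le_etaKL κ) (etaKL_le_etaChiSq κ)

/-!
# Proof of Polyanskiy–Wu 2017, Theorem 5 (percolation of information)

This second part of the file DISCHARGES the named fact `PolyanskiyWu2017_thm5` of
`Literature/Probability/Entropy/StrongDataProcessing.lean`:
`theorem PolyanskiyWu2017_thm5_holds : PolyanskiyWu2017_thm5` — for a Bayesian network on a
finite, topologically sorted DAG with finite alphabets, one external source `X` and target set
`V`, `η_KL(P_{Y_V|X}) ≤ perc(V)` where node `v` is retained with probability
`η_v = η_KL(P_{Y_v | X, Y_{pa v}})`.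

Source: Y. Polyanskiy, Y. Wu, *Strong data-processing inequalities for channels and Bayesian
networks*, Convexity and Concentration (IMA Vol. 161), Springer 2017, arXiv:1508.06025, §3,
Theorem 5 and its proof.

## Architecture (the printed proof, and where we deviate)

The printed proof has three parts. (i) The one-node recursion (9):
`η_KL(P_{V,W|X}) ≤ η_W η_KL(P_{V,pa W|X}) + (1-η_W) η_KL(P_{V|X})` for `W > V`, obtained from the
chain rule `I(U;V,W) = I(U;V) + I(U;W|V)`, the conditional Markov structure
`U → X → A → W | V` (`A = pa W ∖ V`) with the channel `P_{W|A,C=c}` a restriction of `P_{W|pa W}`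
((14)–(16)), and the mutual-information characterisation (13) of `η_KL`. (ii) The set function
`perc` satisfies the same recursion with equality (condition on `W` kept / removed).
(iii) Induction on the maximal element of `V`.

We follow (ii) and (iii) literally (`BayesNet.perc_insert`, `etaKL_marginal_le_perc`). For (i)
we prove the recursion DIRECTLY FOR DIVERGENCES, which avoids Theorem 4 / (13): for input laws
`P ≪ Q` of the source, the chain rule for KL (`InformationTheory.klDiv_compProd_eq_add`, Mathlib)
gives `D(P_{S,W}‖Q_{S,W}) = D(P_S‖Q_S) + D(P_{W|S}‖Q_{W|S} | P_S)` and
`D(P_T‖Q_T) = D(P_S‖Q_S) + D(P_{T|S}‖Q_{T|S} | P_S)` for `S = π(T)`; since `W ∼ K(T)` with the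
same channel `K` under `P` and `Q`, the fibrewise SDPI `D(K∘a ‖ K∘b) ≤ η_KL(K) D(a‖b)` bounds the
first conditional term by `η` times the second (`klDiv_compProd_comp_le`), whence the abstract
one-step inequality `klDiv_map_compProd_le`:
`D(P_{S,W}‖Q_{S,W}) ≤ (1-η) D(P_S‖Q_S) + η D(P_T‖Q_T)`. Instantiated with
`T = (X, Y_{<W})` it gives (9) with `η_KL(P_{V,pa W|X})` replaced by `1` (the case `X ∈ pa W`,
`BayesNet.klDiv_marginal_insert_le`); instantiated with `T = Y_{V ∪ pa W}` and the channel of `W`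
factored through these coordinates (locality, `X ∉ pa W`; restriction does not increase `η`,
`etaKL_comap_le` = PW17 (15)) it gives (9) itself
(`BayesNet.klDiv_marginal_insert_le_of_src_eq_false`).

## Contents

* finite-alphabet KL toolkit: `toReal_klDiv_fintype` (`D = ∑ μ log (μ/ν)`), point masses of
  `⊗ₘ`, `∘ₘ`, `map`; `klDiv_map_of_measurableEmbedding`; the data-processing inequality
  `klDiv_comp_le` (chain rule + disintegration) and `etaKL_le_one`;
* `klDiv_map_compProd_le` (abstract (9)), `toReal_klDiv_compProd_right` (conditional KL as a
  fibre average), `klDiv_compProd_comp_le` (conditional SDPI);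
* structure of `BayesNet.condLaw`: prefix property `map_condLaw_eq_map_foldl_take`, the law of
  `(Y_V, Y_W)` as `((P ⊗ P_{Y_{<W}|X}) ⊗ K_W)` pushed forward (`map_marginal_insert_comp`);
* percolation: path lemmas on the sorted DAG and `BayesNet.perc_insert`, `BayesNet.perc_empty`;
* `etaKL_marginal_le_perc` (induction) and `PolyanskiyWu2017_thm5_holds`.

All alphabets in the network part are finite with measurable singletons, so every map is
measurable (`measurable_of_countable`) and measures are compared on singletons.
-/

/-! ### KL divergence on finite alphabets -/

section FiniteKL

variable {T : Type*} [MeasurableSpace T] [MeasurableSingletonClass T]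

/-- On a space with measurable singletons, the Radon–Nikodym derivative at a point of positive
mass is the ratio of the point masses. [folklore] -/
theorem rnDeriv_singleton (μ ν : Measure T) [SigmaFinite μ] [SigmaFinite ν] (hμν : μ ≪ ν)
    (t : T) (ht : ν {t} ≠ 0) (ht' : ν {t} ≠ ∞) : μ.rnDeriv ν t = μ {t} / ν {t} := by
  have h := Measure.setLIntegral_rnDeriv hμν {t}
  rw [lintegral_singleton] at h
  rw [← h, mul_div_assoc, ENNReal.div_self ht ht', mul_one]

/-- On a finite alphabet the KL divergence of `μ ≪ ν` is finite. [folklore] -/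
theorem klDiv_ne_top_of_fintype [Fintype T] (μ ν : Measure T) [IsFiniteMeasure μ]
    [IsFiniteMeasure ν] (hμν : μ ≪ ν) : klDiv μ ν ≠ ∞ :=
  klDiv_ne_top hμν Integrable.of_finite

/-- **KL divergence on a finite alphabet**: `D(μ‖ν) = ∑ₜ μ(t) log (μ(t)/ν(t))` for probability
measures `μ ≪ ν`. [folklore] -/
theorem toReal_klDiv_fintype [Fintype T] (μ ν : Measure T) [IsProbabilityMeasure μ]
    [IsProbabilityMeasure ν] (hμν : μ ≪ ν) :
    (klDiv μ ν).toReal = ∑ t, (μ {t}).toReal * Real.log ((μ {t}).toReal / (ν {t}).toReal) := by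
  rw [toReal_klDiv_of_measure_eq hμν (by simp), integral_fintype Integrable.of_finite]
  refine Finset.sum_congr rfl fun t _ => ?_
  rw [smul_eq_mul, measureReal_def]
  by_cases ht : ν {t} = 0
  · have : μ {t} = 0 := hμν ht
    simp [this]
  · congr 1
    rw [llr_def]
    simp only
    rw [rnDeriv_singleton μ ν hμν t ht (measure_ne_top ν _), ENNReal.toReal_div]

end FiniteKL

/-! ### Point masses of composite laws on finite alphabets -/

section PointMasses

variable {S W : Type*} [MeasurableSpace S] [MeasurableSpace W] [MeasurableSingletonClass S]
  [MeasurableSingletonClass W]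

/-- `(μ ⊗ κ)(s,w) = μ(s) κ(s)(w)`. [folklore] -/
theorem compProd_singleton (μ : Measure S) [SFinite μ] (κ : Kernel S W) [IsSFiniteKernel κ]
    (s : S) (w : W) : (μ ⊗ₘ κ) {(s, w)} = μ {s} * κ s {w} := by
  rw [← Set.singleton_prod_singleton,
    Measure.compProd_apply_prod (measurableSet_singleton s) (measurableSet_singleton w),
    lintegral_singleton, mul_comm]

/-- `(κ ∘ μ)(w) = ∑ₛ μ(s) κ(s)(w)` on a finite input alphabet. [folklore] -/
theorem comp_singleton [Fintype S] (μ : Measure S) (κ : Kernel S W) (w : W) :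
    (κ ∘ₘ μ) {w} = ∑ s, μ {s} * κ s {w} := by
  rw [Measure.bind_apply (measurableSet_singleton w) κ.aemeasurable, lintegral_fintype]
  exact Finset.sum_congr rfl fun s _ => mul_comm _ _

/-- Point masses of a push-forward on a finite alphabet. [folklore] -/
theorem map_singleton [Fintype S] (μ : Measure S) {f : S → W} (hf : Measurable f) (w : W)
    [DecidablePred fun s => f s = w] :
    (μ.map f) {w} = ∑ s ∈ Finset.univ.filter (fun s => f s = w), μ {s} := by
  rw [Measure.map_apply hf (measurableSet_singleton w), sum_measure_singleton]
  congr 1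
  ext s
  simp

end PointMasses

/-! ### Invariance under embeddings and the data-processing inequality -/

section DPI

variable {α β : Type*} [MeasurableSpace α] [MeasurableSpace β]

/-- KL divergence is invariant under a measurable embedding (in particular a measurable
equivalence) applied to both measures. [folklore] -/
theorem klDiv_map_of_measurableEmbedding {f : α → β} (hf : MeasurableEmbedding f)
    (μ ν : Measure α) [IsFiniteMeasure μ] [IsFiniteMeasure ν] :
    klDiv (μ.map f) (ν.map f) = klDiv μ ν := by
  by_cases hμν : μ ≪ ν
  · have h1 : μ.map f ≪ ν.map f := hμν.map hf.measurable
    rw [klDiv_eq_lintegral_klFun_of_ac h1, klDiv_eq_lintegral_klFun_of_ac hμν, hf.lintegral_map]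
    refine lintegral_congr_ae ?_
    filter_upwards [hf.rnDeriv_map μ ν] with x hx
    rw [hx]
  · have h1 : ¬ μ.map f ≪ ν.map f := by
      intro h
      refine hμν (Measure.AbsolutelyContinuous.mk fun s _ hνs => ?_)
      have := h (s := f '' s) (by rw [hf.map_apply, hf.injective.preimage_image]; exact hνs)
      rwa [hf.map_apply, hf.injective.preimage_image] at this
    rw [klDiv_of_not_ac hμν, klDiv_of_not_ac h1]

/-- **Data-processing inequality for KL divergence** (composition with a Markov kernel), from
the chain rule and disintegration of the swapped joint laws. [folklore] -/
theorem klDiv_comp_le [StandardBorelSpace α] [Nonempty α] (P Q : Measure α) [IsFiniteMeasure P]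
    [IsFiniteMeasure Q] (κ : Kernel α β) [IsMarkovKernel κ] :
    klDiv (κ ∘ₘ P) (κ ∘ₘ Q) ≤ klDiv P Q := by
  set ρP : Measure (β × α) := (P ⊗ₘ κ).map Prod.swap with hρP
  set ρQ : Measure (β × α) := (Q ⊗ₘ κ).map Prod.swap with hρQ
  have hPf : ρP.fst = κ ∘ₘ P := by rw [hρP, Measure.fst_map_swap, Measure.snd_compProd]
  have hQf : ρQ.fst = κ ∘ₘ Q := by rw [hρQ, Measure.fst_map_swap, Measure.snd_compProd]
  have h1 : klDiv ρP ρQ = klDiv P Q := by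
    have hsw : MeasurableEmbedding (Prod.swap : α × β → β × α) :=
      (MeasurableEquiv.prodComm : α × β ≃ᵐ β × α).measurableEmbedding
    rw [hρP, hρQ, klDiv_map_of_measurableEmbedding hsw, klDiv_compProd_left]
  have h2 : klDiv ρP ρQ = klDiv ρP.fst ρQ.fst +
      klDiv (ρP.fst ⊗ₘ ρP.condKernel) (ρP.fst ⊗ₘ ρQ.condKernel) := by
    conv_lhs => rw [← ρP.disintegrate ρP.condKernel, ← ρQ.disintegrate ρQ.condKernel]
    rw [klDiv_compProd_eq_add]
  calc klDiv (κ ∘ₘ P) (κ ∘ₘ Q) = klDiv ρP.fst ρQ.fst := by rw [hPf, hQf]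
    _ ≤ klDiv ρP ρQ := by rw [h2]; exact le_self_add
    _ = klDiv P Q := h1

/-- `η_KL(κ) ≤ 1` for a Markov kernel out of a standard Borel space. [cite: PolyanskiyWu2017, §2.1] -/
theorem etaKL_le_one [StandardBorelSpace α] [Nonempty α] (κ : Kernel α β) [IsMarkovKernel κ] :
    etaKL κ ≤ 1 := by
  refine etaKL_le_of_forall κ fun P Q hP hQ h0 htop => ?_
  rw [ENNReal.div_le_iff h0 htop, one_mul]
  exact klDiv_comp_le P Q κ

/-- The SDPI in product form: `D(κ∘P ‖ κ∘Q) ≤ η_KL(κ) D(P‖Q)` whenever `D(P‖Q) < ∞`.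
[cite: PolyanskiyWu2017, §2.1 eqs. (1)–(2)] -/
theorem klDiv_comp_le_etaKL_mul {γ : Type*} [MeasurableSpace γ] (κ : Kernel α γ)
    [IsFiniteKernel κ] (P Q : Measure α) [IsProbabilityMeasure P] [IsProbabilityMeasure Q] (htop : klDiv P Q ≠ ∞) :
    klDiv (κ ∘ₘ P) (κ ∘ₘ Q) ≤ etaKL κ * klDiv P Q := by
  by_cases h0 : klDiv P Q = 0
  · have hPQ : P = Q := klDiv_eq_zero_iff.1 h0
    subst hPQ
    simp [klDiv_self]
  exact (ENNReal.div_le_iff h0 htop).1 (div_le_etaKL κ P Q h0 htop)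

end DPI

/-! ### The one-step divergence recursion (abstract form of PW17 (9)) -/

section Step

variable {S T W : Type*} [MeasurableSpace S] [MeasurableSpace T] [MeasurableSpace W]
  [MeasurableSingletonClass S] [MeasurableSingletonClass T] [MeasurableSingletonClass W]

omit [MeasurableSingletonClass T] in
/-- On a countable alphabet absolute continuity is decided on singletons. [folklore] -/
theorem absolutelyContinuous_of_singleton [Countable T] {μ ν : Measure T}
    (h : ∀ t, ν {t} = 0 → μ {t} = 0) : μ ≪ ν := fun s hs => by
  rw [measure_null_iff_singleton (Set.to_countable s)] at hs ⊢
  exact fun t ht => h t (hs t ht)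

/-- **Conditional KL divergence on finite alphabets**: `D(μ ⊗ κ₁ ‖ μ ⊗ κ₂) = ∑ₛ μ(s) D(κ₁ s ‖ κ₂ s)`.
[folklore] -/
theorem toReal_klDiv_compProd_right [Fintype S] [Fintype W] (μ : Measure S)
    [IsProbabilityMeasure μ] (κ₁ κ₂ : Kernel S W) [IsMarkovKernel κ₁] [IsMarkovKernel κ₂]
    (hac : ∀ s, μ {s} ≠ 0 → κ₁ s ≪ κ₂ s) :
    (klDiv (μ ⊗ₘ κ₁) (μ ⊗ₘ κ₂)).toReal =
      ∑ s, (μ {s}).toReal * (klDiv (κ₁ s) (κ₂ s)).toReal := by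
  have hac' : μ ⊗ₘ κ₁ ≪ μ ⊗ₘ κ₂ :=
    Measure.AbsolutelyContinuous.compProd_right (by rw [ae_iff_of_countable]; exact hac)
  rw [toReal_klDiv_fintype _ _ hac', Fintype.sum_prod_type]
  refine Finset.sum_congr rfl fun s _ => ?_
  by_cases hs : μ {s} = 0
  · simp [compProd_singleton, hs]
  · rw [toReal_klDiv_fintype _ _ (hac s hs), Finset.mul_sum]
    refine Finset.sum_congr rfl fun w _ => ?_
    rw [compProd_singleton, compProd_singleton, ENNReal.toReal_mul, ENNReal.toReal_mul]
    have hs' : (μ {s}).toReal ≠ 0 := by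
      rw [ENNReal.toReal_ne_zero]; exact ⟨hs, measure_ne_top _ _⟩
    rw [mul_div_mul_left _ _ hs', mul_assoc]

/-- **Conditional SDPI**: if each fibre law of `W` is obtained from the fibre law of `T` through
the same channel `K` with `η_KL(K) ≤ η`, the conditional divergences contract by `η`:
`D(μ ⊗ (K∘α) ‖ μ ⊗ (K∘β)) ≤ η · D(μ ⊗ α ‖ μ ⊗ β)` (finite alphabets). This is the divergence
form of the averaging step `I(U;W|V) ≤ η_W I(U;A|V)` in the proof of PW17 Thm 5.
[cite: PolyanskiyWu2017, Thm 5 (proof, eqs. (14)–(16))] -/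
theorem klDiv_compProd_comp_le [Fintype S] [Fintype T] [Fintype W] (μ : Measure S)
    [IsProbabilityMeasure μ] (α β : Kernel S T) [IsMarkovKernel α] [IsMarkovKernel β]
    (K : Kernel T W) [IsMarkovKernel K] (hac : ∀ s, μ {s} ≠ 0 → α s ≪ β s) {η : ℝ}
    (hη : 0 ≤ η) (hK : etaKL K ≤ ENNReal.ofReal η) :
    klDiv (μ ⊗ₘ (K ∘ₖ α)) (μ ⊗ₘ (K ∘ₖ β)) ≤ ENNReal.ofReal η * klDiv (μ ⊗ₘ α) (μ ⊗ₘ β) := by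
  have hacK : ∀ s, μ {s} ≠ 0 → (K ∘ₖ α) s ≪ (K ∘ₖ β) s := fun s hs => by
    rw [Kernel.comp_apply, Kernel.comp_apply]
    exact (hac s hs).comp_right K
  have h1 : klDiv (μ ⊗ₘ (K ∘ₖ α)) (μ ⊗ₘ (K ∘ₖ β)) ≠ ∞ :=
    klDiv_ne_top_of_fintype _ _
      (Measure.AbsolutelyContinuous.compProd_right (by rw [ae_iff_of_countable]; exact hacK))
  have h2 : klDiv (μ ⊗ₘ α) (μ ⊗ₘ β) ≠ ∞ :=
    klDiv_ne_top_of_fintype _ _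
      (Measure.AbsolutelyContinuous.compProd_right (by rw [ae_iff_of_countable]; exact hac))
  rw [← ENNReal.ofReal_toReal h1, ← ENNReal.ofReal_toReal h2, ← ENNReal.ofReal_mul hη]
  refine ENNReal.ofReal_le_ofReal ?_
  rw [toReal_klDiv_compProd_right μ _ _ hacK, toReal_klDiv_compProd_right μ _ _ hac,
    Finset.mul_sum]
  refine Finset.sum_le_sum fun s _ => ?_
  by_cases hs : μ {s} = 0
  · simp [hs]
  rw [mul_left_comm]
  refine mul_le_mul_of_nonneg_left ?_ ENNReal.toReal_nonneg
  have h3 : klDiv (α s) (β s) ≠ ∞ := klDiv_ne_top_of_fintype _ _ (hac s hs)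
  have h4 : klDiv (K ∘ₘ α s) (K ∘ₘ β s) ≤ ENNReal.ofReal η * klDiv (α s) (β s) :=
    (klDiv_comp_le_etaKL_mul K (α s) (β s) h3).trans (mul_le_mul' hK le_rfl)
  rw [Kernel.comp_apply, Kernel.comp_apply, ← ENNReal.toReal_ofReal hη, ← ENNReal.toReal_mul]
  exact ENNReal.toReal_mono (ENNReal.mul_ne_top ENNReal.ofReal_ne_top h3) h4

/-- Point masses of the graph measure `μ.map (π, id)`. [folklore] -/
theorem map_graph_singleton [Fintype T] (μ : Measure T) (π : T → S) (s : S) (t : T)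
    [Decidable (π t = s)] :
    (μ.map fun t => (π t, t)) {(s, t)} = if π t = s then μ {t} else 0 := by
  rw [Measure.map_apply (measurable_of_countable _) (measurableSet_singleton _)]
  by_cases h : π t = s
  · rw [if_pos h]; congr 1; ext t'; simp only [Set.mem_preimage, Set.mem_singleton_iff,
      Prod.ext_iff]; exact ⟨fun h' => h'.2, fun h' => ⟨h' ▸ h, h'⟩⟩
  · rw [if_neg h]
    convert measure_empty (μ := μ)
    ext t'; simp [Prod.ext_iff]; rintro h' rfl; exact h h'

/-- Point masses of the joint law `(π(T), W)` when `W ∼ K(T)`. [folklore] -/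
theorem map_compProd_prodMap_singleton [Fintype T] (μ : Measure T) [SFinite μ] (π : T → S)
    (K : Kernel T W) [IsSFiniteKernel K] (s : S) (w : W) [DecidablePred fun t => π t = s] :
    ((μ ⊗ₘ K).map (Prod.map π id)) {(s, w)} =
      ∑ t ∈ Finset.univ.filter (fun t => π t = s), μ {t} * K t {w} := by
  rw [Measure.map_apply ((measurable_of_countable π).prodMap measurable_id)
    (measurableSet_singleton _)]
  have : Prod.map π id ⁻¹' {(s, w)} = (↑(Finset.univ.filter fun t => π t = s) : Set T) ×ˢ {w} := by
    ext ⟨t, w'⟩; simp [Prod.ext_iff]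
  rw [this, Measure.compProd_apply_prod (Finset.measurableSet _) (measurableSet_singleton w),
    lintegral_finset]
  exact Finset.sum_congr rfl fun t _ => mul_comm _ _

/-- **The one-step divergence recursion (abstract form).** Let `T ∼ μ` or `ν`, `S = π(T)` and
`W ∼ K(T)`. If `η_KL(K) ≤ η ≤ 1` then
`D(P_{S,W} ‖ Q_{S,W}) ≤ (1-η) D(P_S ‖ Q_S) + η D(P_T ‖ Q_T)`.
Proof: two chain rules (`klDiv_compProd_eq_add`) through the disintegration of the graph
measure of `π` and the conditional SDPI. This is PW17 (14) ⟹ (9) with mutual information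
replaced by divergence. [cite: PolyanskiyWu2017, Thm 5 (proof of (9))] -/
theorem klDiv_map_compProd_le [Fintype S] [Fintype T] [Fintype W] [Nonempty T]
    (μ ν : Measure T) [IsProbabilityMeasure μ] [IsProbabilityMeasure ν] (hμν : μ ≪ ν)
    (π : T → S) (K : Kernel T W) [IsMarkovKernel K] {η : ℝ} (hη0 : 0 ≤ η) (hη1 : η ≤ 1)
    (hK : etaKL K ≤ ENNReal.ofReal η) :
    klDiv ((μ ⊗ₘ K).map (Prod.map π id)) ((ν ⊗ₘ K).map (Prod.map π id)) ≤
      ENNReal.ofReal (1 - η) * klDiv (μ.map π) (ν.map π) + ENNReal.ofReal η * klDiv μ ν := by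
  classical
  -- the graph embedding of `π`
  set e : T → S × T := fun t => (π t, t) with he_def
  have he : MeasurableEmbedding e :=
    { injective := fun t t' h => (Prod.ext_iff.1 h).2
      measurable := measurable_of_countable _
      measurableSet_image' := fun s _ => (Set.to_countable _).measurableSet }
  have hπ : Measurable π := measurable_of_countable _
  set μS := μ.map π with hμS
  set νS := ν.map π with hνS
  haveI : IsProbabilityMeasure μS := Measure.isProbabilityMeasure_map hπ.aemeasurable
  haveI : IsProbabilityMeasure νS := Measure.isProbabilityMeasure_map hπ.aemeasurable
  have hfst_μ : (μ.map e).fst = μS := Measure.fst_map_prodMk measurable_id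
  have hfst_ν : (ν.map e).fst = νS := Measure.fst_map_prodMk measurable_id
  set α := (μ.map e).condKernel with hα
  set β := (ν.map e).condKernel with hβ
  have hμe : μ.map e = μS ⊗ₘ α := by rw [← hfst_μ]; exact ((μ.map e).disintegrate α).symm
  have hνe : ν.map e = νS ⊗ₘ β := by rw [← hfst_ν]; exact ((ν.map e).disintegrate β).symm
  -- point masses of the disintegrations
  have hμα : ∀ s t, μS {s} * α s {t} = if π t = s then μ {t} else 0 := fun s t => by
    rw [← compProd_singleton, ← hμe, he_def, map_graph_singleton]
  have hνβ : ∀ s t, νS {s} * β s {t} = if π t = s then ν {t} else 0 := fun s t => by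
    rw [← compProd_singleton, ← hνe, he_def, map_graph_singleton]
  -- fibrewise absolute continuity
  have hac : ∀ s, μS {s} ≠ 0 → α s ≪ β s := fun s hs => by
    refine absolutelyContinuous_of_singleton fun t ht => ?_
    have h1 := hμα s t
    have h2 := hνβ s t
    rw [ht, mul_zero] at h2
    by_cases hts : π t = s
    · rw [if_pos hts] at h1 h2
      have : μ {t} = 0 := hμν h2.symm
      rw [this, mul_eq_zero] at h1
      exact h1.resolve_left hs
    · rw [if_neg hts, mul_eq_zero] at h1
      exact h1.resolve_left hs
  -- the joint laws of `(S, W)` disintegrate through `K ∘ α`, `K ∘ β`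
  have hJ : ∀ (ρ : Measure T) [IsProbabilityMeasure ρ] (γ : Kernel S T) [IsMarkovKernel γ],
      (∀ s t, (ρ.map π) {s} * γ s {t} = if π t = s then ρ {t} else 0) →
      (ρ ⊗ₘ K).map (Prod.map π id) = (ρ.map π) ⊗ₘ (K ∘ₖ γ) := by
    intro ρ _ γ _ hγ
    refine Measure.ext_of_singleton fun ⟨s, w⟩ => ?_
    rw [map_compProd_prodMap_singleton, compProd_singleton, Kernel.comp_apply, comp_singleton,
      Finset.mul_sum, Finset.sum_filter]
    refine Finset.sum_congr rfl fun t _ => ?_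
    rw [← mul_assoc, hγ s t]
    split_ifs <;> simp
  have hJμ := hJ μ α hμα
  have hJν := hJ ν β hνβ
  -- chain rule, twice
  have hchain1 : klDiv μ ν = klDiv μS νS + klDiv (μS ⊗ₘ α) (μS ⊗ₘ β) := by
    rw [← klDiv_map_of_measurableEmbedding he μ ν, hμe, hνe, klDiv_compProd_eq_add]
  have hchain2 : klDiv ((μ ⊗ₘ K).map (Prod.map π id)) ((ν ⊗ₘ K).map (Prod.map π id)) =
      klDiv μS νS + klDiv (μS ⊗ₘ (K ∘ₖ α)) (μS ⊗ₘ (K ∘ₖ β)) := by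
    rw [hJμ, hJν, klDiv_compProd_eq_add]
  have hcond := klDiv_compProd_comp_le μS α β K hac hη0 hK
  rw [hchain2, hchain1, mul_add, ← add_assoc, ← add_mul, ← ENNReal.ofReal_add (by linarith) hη0,
    sub_add_cancel, ENNReal.ofReal_one, one_mul]
  exact add_le_add le_rfl hcond

end Step

/-! ### Kernel algebra used to identify the laws of a Bayesian network -/

section KernelAlgebra

variable {X Y Z : Type*} [MeasurableSpace X] [MeasurableSpace Y] [MeasurableSpace Z]

/-- Restricting a channel along an embedding of inputs does not increase `η_KL`
(PW17 (15): `sup_c η(P_{W|A,C=c}) ≤ η(P_{W|A,C})`). [cite: PolyanskiyWu2017, Thm 5 (proof, (15))] -/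
theorem etaKL_comap_le (κ : Kernel X Y) {g : Z → X} (hg : MeasurableEmbedding g) :
    etaKL (κ.comap g hg.measurable) ≤ etaKL κ := by
  refine etaKL_le_of_forall _ fun P Q hP hQ h0 htop => ?_
  have hcomp : ∀ μ : Measure Z, (κ.comap g hg.measurable) ∘ₘ μ = κ ∘ₘ (μ.map g) := fun μ => by
    rw [← Measure.deterministic_comp_eq_map hg.measurable, Measure.comp_assoc,
      Kernel.comp_deterministic_eq_comap]
  have hPQ : klDiv (P.map g) (Q.map g) = klDiv P Q := klDiv_map_of_measurableEmbedding hg P Q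
  haveI := Measure.isProbabilityMeasure_map (μ := P) hg.measurable.aemeasurable
  haveI := Measure.isProbabilityMeasure_map (μ := Q) hg.measurable.aemeasurable
  rw [hcomp, hcomp, ← hPQ]
  exact div_le_etaKL κ (P.map g) (Q.map g) (by rwa [hPQ]) (by rwa [hPQ])

/-- `(L ⊗ K) ∘ P` is the `(Y, Z)`-marginal of `(P ⊗ L) ⊗ K`. [folklore] -/
theorem comp_compProd_eq_map (P : Measure X) [SFinite P] (L : Kernel X Y) [IsSFiniteKernel L]
    (K : Kernel (X × Y) Z) [IsSFiniteKernel K] :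
    (L ⊗ₖ K) ∘ₘ P = ((P ⊗ₘ L) ⊗ₘ K).map (fun p => (p.1.2, p.2)) := by
  have hm : Measurable (fun p : (X × Y) × Z => (p.1.2, p.2)) := by fun_prop
  rw [← Measure.compProd_assoc, Measure.map_map hm (MeasurableEquiv.measurable _)]
  have : (fun p : (X × Y) × Z => (p.1.2, p.2)) ∘ ⇑(MeasurableEquiv.prodAssoc.symm) =
      (Prod.snd : X × (Y × Z) → Y × Z) := by
    funext ⟨x, y, z⟩; rfl
  rw [this]
  exact (Measure.snd_compProd P (L ⊗ₖ K)).symm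

/-- Composition-product of a push-forward with a channel that factors through the map
(finite alphabets). [folklore] -/
theorem map_compProd_eq_map_compProd {T₀ T : Type*} [MeasurableSpace T₀] [MeasurableSpace T]
    [Fintype T₀] [Fintype T] [Countable Z] [MeasurableSingletonClass T₀]
    [MeasurableSingletonClass T] [MeasurableSingletonClass Z] (ρ : Measure T₀) [SFinite ρ]
    (g : T₀ → T) (K₀ : Kernel T₀ Z) [IsSFiniteKernel K₀] (K : Kernel T Z) [IsSFiniteKernel K]
    (h : ∀ t₀, K₀ t₀ = K (g t₀)) :
    (ρ.map g) ⊗ₘ K = (ρ ⊗ₘ K₀).map (Prod.map g id) := by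
  classical
  refine Measure.ext_of_singleton fun ⟨t, z⟩ => ?_
  rw [compProd_singleton, map_compProd_prodMap_singleton,
    map_singleton ρ (measurable_of_countable g), Finset.sum_mul]
  refine Finset.sum_congr rfl fun t₀ ht₀ => ?_
  rw [h t₀, (Finset.mem_filter.1 ht₀).2]

end KernelAlgebra

/-! ### Structure of the laws of a Bayesian network -/

namespace BayesNet

variable {N : ℕ} {A B : Type*} [MeasurableSpace A] [MeasurableSpace B] (G : BayesNet N A B)

/-- A sampling step at node `v` is invisible to statistics that do not read coordinate `v`.
[folklore] -/
theorem map_step_of_forall_update (v : Fin N) (κ : Kernel B (Fin N → A)) [IsMarkovKernel κ]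
    {γ : Type*} [MeasurableSpace γ] {f : (Fin N → A) → γ} (hf : Measurable f)
    (h : ∀ y a, f (Function.update y v a) = f y) : (G.step v κ).map f = κ.map f := by
  unfold step
  rw [← Kernel.map_comp_right _ measurable_update' hf]
  have : f ∘ (fun p : (Fin N → A) × A => Function.update p.1 v p.2) = f ∘ Prod.fst :=
    funext fun p => h p.1 p.2
  rw [this, Kernel.map_comp_right _ measurable_fst hf, ← Kernel.fst_eq, Kernel.fst_compProd]

/-- Folding sampling steps over nodes that a statistic does not read leaves its law unchanged.
[folklore] -/
theorem map_foldl_step_of_forall {γ : Type*} [MeasurableSpace γ] {f : (Fin N → A) → γ}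
    (hf : Measurable f) (l : List (Fin N))
    (h : ∀ v ∈ l, ∀ y a, f (Function.update y v a) = f y) (κ : Kernel B (Fin N → A))
    [IsMarkovKernel κ] : (l.foldl (fun κ v => G.step v κ) κ).map f = κ.map f := by
  induction l generalizing κ with
  | nil => rfl
  | cons v l ih =>
    rw [List.foldl_cons, ih (fun u hu => h u (List.mem_cons_of_mem v hu)) (G.step v κ),
      G.map_step_of_forall_update v κ hf (h v List.mem_cons_self)]

/-- Elements of `(finRange N).drop k` have value `≥ k`. [folklore] -/
theorem le_of_mem_drop_finRange {k : ℕ} {v : Fin N} (hv : v ∈ (List.finRange N).drop k) :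
    k ≤ v.val := by
  obtain ⟨i, hi, rfl⟩ := List.mem_iff_getElem.1 hv
  simp

/-- **Prefix property of `condLaw`.** A statistic that does not read the coordinates `≥ k` has
the same law under `P_{Y|X}` as under the law of the first `k` sampling steps.
[cite: PolyanskiyWu2017, §3 (topological sorting)] -/
theorem map_condLaw_eq_map_foldl_take [Nonempty A] {γ : Type*} [MeasurableSpace γ]
    {f : (Fin N → A) → γ} (hf : Measurable f) (k : ℕ)
    (h : ∀ v : Fin N, k ≤ v.val → ∀ y a, f (Function.update y v a) = f y) :
    G.condLaw.map f = (((List.finRange N).take k).foldl (fun κ v => G.step v κ)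
      (Kernel.const B (Measure.dirac fun _ => Classical.arbitrary A))).map f := by
  haveI : IsMarkovKernel (((List.finRange N).take k).foldl (fun κ v => G.step v κ)
      (Kernel.const B (Measure.dirac fun _ => Classical.arbitrary A))) :=
    G.isMarkovKernel_foldl _ _
  unfold condLaw
  conv_lhs => rw [← List.take_append_drop k (List.finRange N), List.foldl_append]
  exact G.map_foldl_step_of_forall hf _
    (fun v hv => h v (le_of_mem_drop_finRange hv)) _

/-- The first `W+1` sampling steps are the first `W` steps followed by the step at `W`.
[folklore] -/
theorem foldl_take_succ [Nonempty A] (W : Fin N) :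
    ((List.finRange N).take (W.val + 1)).foldl (fun κ v => G.step v κ)
        (Kernel.const B (Measure.dirac fun _ => Classical.arbitrary A)) =
      G.step W (((List.finRange N).take W.val).foldl (fun κ v => G.step v κ)
        (Kernel.const B (Measure.dirac fun _ => Classical.arbitrary A))) := by
  have : (List.finRange N)[W.val]?.toList = [W] := by simp [W.2]
  rw [List.take_add_one, this, List.foldl_append, List.foldl_cons, List.foldl_nil]

section Laws

variable [Fintype A] [Fintype B] [MeasurableSingletonClass A] [MeasurableSingletonClass B]
  [Nonempty A]

omit [Fintype B] [MeasurableSingletonClass B] in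
/-- `P_{Y_V | X}` only involves the first `W` sampling steps when every `v ∈ V` precedes `W`.
[cite: PolyanskiyWu2017, §3] -/
theorem marginal_eq_map_foldl_take (W : Fin N) (V : Finset (Fin N)) (hV : ∀ v ∈ V, v < W) :
    G.marginal V = (((List.finRange N).take W.val).foldl (fun κ v => G.step v κ)
      (Kernel.const B (Measure.dirac fun _ => Classical.arbitrary A))).map
        fun y (v : V) => y v := by
  unfold marginal
  refine G.map_condLaw_eq_map_foldl_take (measurable_of_countable _) W.val fun v hv y a => ?_
  funext u
  have hu : (u : Fin N) < W := hV u u.2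
  exact Function.update_of_ne (fun h => by rw [h] at hu; exact absurd hv (not_le.2 hu)) _ _

omit [MeasurableSingletonClass B] in
/-- For `R` a probability law of the source, `(R ⊗ P_{Y_{<W}|X})` pushed to the `V`-coordinates
is `P_{Y_V|X} ∘ R` (`V ⊆ {v < W}`). [folklore] -/
theorem map_compProd_foldl_take (W : Fin N) (V : Finset (Fin N)) (hV : ∀ v ∈ V, v < W)
    (R : Measure B) [IsProbabilityMeasure R] :
    (R ⊗ₘ ((List.finRange N).take W.val).foldl (fun κ v => G.step v κ)
      (Kernel.const B (Measure.dirac fun _ => Classical.arbitrary A))).map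
        (fun t : B × (Fin N → A) => fun v : V => t.2 v) = G.marginal V ∘ₘ R := by
  haveI : IsMarkovKernel (((List.finRange N).take W.val).foldl (fun κ v => G.step v κ)
      (Kernel.const B (Measure.dirac fun _ => Classical.arbitrary A))) :=
    G.isMarkovKernel_foldl _ _
  rw [G.marginal_eq_map_foldl_take W V hV, ← Measure.map_comp R _ (measurable_of_countable _),
    ← Measure.snd_compProd R, Measure.snd,
    Measure.map_map (measurable_of_countable _) measurable_snd]
  rfl

/-- **The law of `(Y_V, Y_W)` given the source**, for `V ⊆ {v < W}`: it is the push-forward of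
`(R ⊗ P_{Y_{<W}|X}) ⊗ P_{Y_W | X, Y}` — i.e. `Y_W` is drawn from the channel of `W` applied to
the source and the previously sampled nodes. [cite: PolyanskiyWu2017, §3] -/
theorem map_marginal_insert_comp (W : Fin N) (V : Finset (Fin N)) (hV : ∀ v ∈ V, v < W)
    (R : Measure B) [IsProbabilityMeasure R] :
    ((G.marginal (insert W V)) ∘ₘ R).map (fun z => (fun v : V => z ⟨v, Finset.mem_insert_of_mem v.2⟩,
        z ⟨W, Finset.mem_insert_self W V⟩)) =
      ((R ⊗ₘ ((List.finRange N).take W.val).foldl (fun κ v => G.step v κ)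
        (Kernel.const B (Measure.dirac fun _ => Classical.arbitrary A))) ⊗ₘ G.kernel W).map
        (Prod.map (fun t : B × (Fin N → A) => fun v : V => t.2 v) id) := by
  set L := ((List.finRange N).take W.val).foldl (fun κ v => G.step v κ)
    (Kernel.const B (Measure.dirac fun _ => Classical.arbitrary A)) with hL
  haveI : IsMarkovKernel L := G.isMarkovKernel_foldl _ _
  -- through the first `W + 1` steps
  have h1 : G.marginal (insert W V) = (G.step W L).map (fun y (v : ↥(insert W V)) => y v) := by
    unfold marginal
    rw [hL, ← G.foldl_take_succ W]
    refine G.map_condLaw_eq_map_foldl_take (measurable_of_countable _) (W.val + 1)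
      fun v hv y a => ?_
    funext u
    have hu : (u : Fin N).val ≤ W.val := by
      rcases Finset.mem_insert.1 u.2 with h | h
      · rw [h]
      · exact (hV _ h).le
    exact Function.update_of_ne (fun h => by rw [h] at hu; omega) _ _
  -- through the composition-product with the channel of `W`
  have h2 : (G.step W L).map (fun y (v : ↥(insert W V)) => y v) = (L ⊗ₖ G.kernel W).map
      ((fun y (v : ↥(insert W V)) => y v) ∘ fun p => Function.update p.1 W p.2) := by
    unfold step
    rw [← Kernel.map_comp_right _ measurable_update' (measurable_of_countable _)]
  rw [h1, h2, ← Measure.map_comp R _ (measurable_of_countable _),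
    Measure.map_map (measurable_of_countable _) (measurable_of_countable _),
    comp_compProd_eq_map, Measure.map_map (measurable_of_countable _) (measurable_of_countable _)]
  congr 1
  funext ⟨⟨x, y⟩, a⟩
  simp only [Function.comp_apply, Prod.map_apply, id_eq]
  refine Prod.ext ?_ ?_
  · funext v
    have : (v : Fin N) ≠ W := fun h => (lt_irrefl W) (h ▸ hV v v.2)
    exact Function.update_of_ne this _ _
  · exact Function.update_self ..

omit [Fintype A] [Fintype B] [MeasurableSingletonClass A] [MeasurableSingletonClass B]
  [Nonempty A] [MeasurableSpace A] G in
/-- A probability law lives on a nonempty alphabet. [folklore] -/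
theorem nonempty_of_prob (P : Measure B) [IsProbabilityMeasure P] : Nonempty B := by
  by_contra h
  rw [not_nonempty_iff] at h
  have := IsProbabilityMeasure.measure_univ (μ := P)
  rw [Set.univ_eq_empty_iff.2 h, measure_empty] at this
  exact zero_ne_one this

omit [Nonempty A] in
/-- The coordinates `(z|_V, z W)` determine `z ∈ A^{V ∪ {W}}`: a measurable embedding.
[folklore] -/
theorem measurableEmbedding_restrict_insert (W : Fin N) (V : Finset (Fin N)) :
    MeasurableEmbedding (fun z : ↥(insert W V) → A =>
      (fun v : V => z ⟨v, Finset.mem_insert_of_mem v.2⟩, z ⟨W, Finset.mem_insert_self W V⟩)) where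
  injective z z' h := by
    obtain ⟨h1, h2⟩ := Prod.ext_iff.1 h
    funext u
    rcases Finset.mem_insert.1 u.2 with hu | hu
    · have : u = ⟨W, Finset.mem_insert_self W V⟩ := Subtype.ext hu
      rw [this]; exact h2
    · exact congr_fun h1 ⟨u, hu⟩
  measurable := measurable_of_countable _
  measurableSet_image' s _ := (Set.to_countable _).measurableSet

/-- **Recursion (9), general node** (divergence form): for `V ⊆ {v < W}` and
`η_KL(P_{Y_W|X,Y}) ≤ η ≤ 1`,
`D(P_{Y_V,Y_W} ‖ Q_{Y_V,Y_W}) ≤ (1-η) D(P_{Y_V} ‖ Q_{Y_V}) + η D(P ‖ Q)`.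
[cite: PolyanskiyWu2017, Thm 5 eq. (9) (case `X ∈ pa(W)`)] -/
theorem klDiv_marginal_insert_le (W : Fin N) (V : Finset (Fin N)) (hV : ∀ v ∈ V, v < W)
    (P Q : Measure B) [IsProbabilityMeasure P] [IsProbabilityMeasure Q] (hPQ : P ≪ Q) {η : ℝ}
    (hη0 : 0 ≤ η) (hη1 : η ≤ 1) (hK : etaKL (G.kernel W) ≤ ENNReal.ofReal η) :
    klDiv (G.marginal (insert W V) ∘ₘ P) (G.marginal (insert W V) ∘ₘ Q) ≤
      ENNReal.ofReal (1 - η) * klDiv (G.marginal V ∘ₘ P) (G.marginal V ∘ₘ Q) +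
        ENNReal.ofReal η * klDiv P Q := by
  haveI : Nonempty B := nonempty_of_prob P
  haveI : IsMarkovKernel (((List.finRange N).take W.val).foldl (fun κ v => G.step v κ)
      (Kernel.const B (Measure.dirac fun _ => Classical.arbitrary A))) :=
    G.isMarkovKernel_foldl _ _
  rw [← klDiv_map_of_measurableEmbedding (measurableEmbedding_restrict_insert (A := A) W V),
    G.map_marginal_insert_comp W V hV P, G.map_marginal_insert_comp W V hV Q]
  set L := ((List.finRange N).take W.val).foldl (fun κ v => G.step v κ)
    (Kernel.const B (Measure.dirac fun _ => Classical.arbitrary A)) with hL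
  have key := klDiv_map_compProd_le (P ⊗ₘ L) (Q ⊗ₘ L) (hPQ.compProd_left L)
    (fun t : B × (Fin N → A) => fun v : V => t.2 v) (G.kernel W) hη0 hη1 hK
  rwa [G.map_compProd_foldl_take W V hV P, G.map_compProd_foldl_take W V hV Q,
    klDiv_compProd_left] at key

/-- **Recursion (9), node not reading the source** (divergence form): for `V ⊆ {v < W}`,
`X ∉ pa(W)` and `η_KL(P_{Y_W|X,Y}) ≤ η ≤ 1`,
`D(P_{Y_V,Y_W} ‖ Q_{Y_V,Y_W}) ≤ (1-η) D(P_{Y_V} ‖ Q_{Y_V}) + η D(P_{Y_{V ∪ pa W}} ‖ Q_{Y_{V ∪ pa W}})`.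
[cite: PolyanskiyWu2017, Thm 5 eq. (9)] -/
theorem klDiv_marginal_insert_le_of_src_eq_false (W : Fin N) (V : Finset (Fin N))
    (hV : ∀ v ∈ V, v < W) (hsrc : G.src W = false) (P Q : Measure B) [IsProbabilityMeasure P]
    [IsProbabilityMeasure Q] (hPQ : P ≪ Q) {η : ℝ} (hη0 : 0 ≤ η) (hη1 : η ≤ 1)
    (hK : etaKL (G.kernel W) ≤ ENNReal.ofReal η) :
    klDiv (G.marginal (insert W V) ∘ₘ P) (G.marginal (insert W V) ∘ₘ Q) ≤
      ENNReal.ofReal (1 - η) * klDiv (G.marginal V ∘ₘ P) (G.marginal V ∘ₘ Q) +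
        ENNReal.ofReal η * klDiv (G.marginal (V ∪ G.pa W) ∘ₘ P)
          (G.marginal (V ∪ G.pa W) ∘ₘ Q) := by
  classical
  haveI : Nonempty B := nonempty_of_prob P
  set L := ((List.finRange N).take W.val).foldl (fun κ v => G.step v κ)
    (Kernel.const B (Measure.dirac fun _ => Classical.arbitrary A)) with hL
  haveI : IsMarkovKernel L := G.isMarkovKernel_foldl _ _
  set U := V ∪ G.pa W with hU
  have hUW : ∀ u ∈ U, u < W := fun u hu =>
    (Finset.mem_union.1 hu).elim (hV u) (G.pa_lt W u)
  obtain ⟨x₀⟩ := (inferInstance : Nonempty B)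
  -- the channel of `W` factored through the `U`-coordinates
  set g₀ : (↥U → A) → B × (Fin N → A) :=
    fun z => (x₀, fun v => if h : v ∈ U then z ⟨v, h⟩ else Classical.arbitrary A) with hg₀_def
  have hg₀ : MeasurableEmbedding g₀ :=
    { injective := fun z z' h => funext fun u => by
        have := congr_fun (Prod.ext_iff.1 h).2 u
        simpa [hg₀_def, u.2] using this
      measurable := measurable_of_countable _
      measurableSet_image' := fun s _ => (Set.to_countable _).measurableSet }
  set KU := (G.kernel W).comap g₀ hg₀.measurable with hKU
  have hfac : ∀ t : B × (Fin N → A), G.kernel W t = KU (fun u : U => t.2 u) := fun t => by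
    rw [hKU, Kernel.comap_apply]
    refine G.local W t.1 x₀ t.2 _ (fun h => by rw [hsrc] at h; exact absurd h Bool.false_ne_true)
      (fun u hu => ?_)
    have huU : u ∈ U := Finset.mem_union_right V hu
    simp [huU]
  have hKU_le : etaKL KU ≤ ENNReal.ofReal η := (etaKL_comap_le _ hg₀).trans hK
  have key := klDiv_map_compProd_le (G.marginal U ∘ₘ P) (G.marginal U ∘ₘ Q) (hPQ.comp_right _)
    (fun z : ↥U → A => fun v : V => z ⟨v, Finset.mem_union_left _ v.2⟩) KU hη0 hη1 hKU_le
  have hπ : ∀ (R : Measure B) [IsProbabilityMeasure R],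
      (G.marginal U ∘ₘ R).map (fun z : ↥U → A => fun v : V => z ⟨v, Finset.mem_union_left _ v.2⟩)
        = G.marginal V ∘ₘ R := fun R _ => by
    rw [Measure.map_comp R _ (measurable_of_countable _)]
    congr 1
    unfold marginal
    rw [← Kernel.map_comp_right _ (measurable_of_countable _) (measurable_of_countable _)]
    rfl
  have hJ : ∀ (R : Measure B) [IsProbabilityMeasure R],
      ((G.marginal U ∘ₘ R) ⊗ₘ KU).map
        (Prod.map (fun z : ↥U → A => fun v : V => z ⟨v, Finset.mem_union_left _ v.2⟩) id) =
      ((R ⊗ₘ L) ⊗ₘ G.kernel W).map (Prod.map (fun t : B × (Fin N → A) => fun v : V => t.2 v) id) :=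
    fun R _ => by
    have hμ : G.marginal U ∘ₘ R = (R ⊗ₘ L).map (fun t : B × (Fin N → A) => fun u : U => t.2 u) :=
      (G.map_compProd_foldl_take W U hUW R).symm
    rw [hμ, map_compProd_eq_map_compProd (R ⊗ₘ L) _ (G.kernel W) KU hfac,
      Measure.map_map (measurable_of_countable _) (measurable_of_countable _), Prod.map_comp_map]
    rfl
  rw [← klDiv_map_of_measurableEmbedding (measurableEmbedding_restrict_insert (A := A) W V),
    G.map_marginal_insert_comp W V hV P, G.map_marginal_insert_comp W V hV Q, ← hJ P, ← hJ Q]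
  rwa [hπ P, hπ Q] at key

end Laws

/-! ### The percolation recursion -/

section Perc

/-- Along a directed path every node precedes the endpoint (the DAG is topologically sorted).
[folklore] -/
theorem le_getLast_of_mem {l : List (Fin N)} (hl : l ≠ [])
    (hc : l.IsChain (fun u w => u ∈ G.pa w)) {u : Fin N} (hu : u ∈ l) : u ≤ l.getLast hl := by
  have hp : l.Pairwise (· < ·) :=
    List.isChain_iff_pairwise.1 (hc.imp fun a b h => G.pa_lt b a h)
  have hsplit := List.dropLast_append_getLast hl
  rw [← hsplit] at hu hp
  rcases List.mem_append.1 hu with h | h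
  · exact le_of_lt ((List.pairwise_append.1 hp).2.2 u h _ (List.mem_singleton_self _))
  · rw [List.mem_singleton.1 h]

/-- A path avoiding `W` by order: if every target precedes `W`, keeping or removing `W` does not
matter. [folklore] -/
theorem hasOpenPath_insert_left {W : Fin N} {S V : Finset (Fin N)} (hV : ∀ v ∈ V, v < W) :
    G.HasOpenPath (insert W S) V ↔ G.HasOpenPath S V := by
  refine ⟨fun ⟨l, hl, h1, h2, h3, h4⟩ => ⟨l, hl, h1, h2, h3, fun u hu => ?_⟩,
    G.hasOpenPath_mono (Finset.subset_insert W S)⟩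
  have hlt : u < W := lt_of_le_of_lt (G.le_getLast_of_mem hl h3 hu) (hV _ h2)
  exact (Finset.mem_insert.1 (h4 u hu)).resolve_left (ne_of_lt hlt)

/-- If `W` is removed, paths to `V ∪ {W}` are paths to `V`. [folklore] -/
theorem hasOpenPath_insert_right {W : Fin N} {S V : Finset (Fin N)} (hW : W ∉ S) :
    G.HasOpenPath S (insert W V) ↔ G.HasOpenPath S V := by
  refine ⟨fun ⟨l, hl, h1, h2, h3, h4⟩ => ⟨l, hl, h1, ?_, h3, h4⟩,
    fun ⟨l, hl, h1, h2, h3, h4⟩ => ⟨l, hl, h1, Finset.mem_insert_of_mem h2, h3, h4⟩⟩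
  exact (Finset.mem_insert.1 h2).resolve_left fun h => hW (h ▸ h4 _ (List.getLast_mem hl))

/-- If `W` reads the source and is kept, there is an open path to `W`. [folklore] -/
theorem hasOpenPath_insert_of_src {W : Fin N} (hsrc : G.src W = true) (S V : Finset (Fin N)) :
    G.HasOpenPath (insert W S) (insert W V) :=
  ⟨[W], List.cons_ne_nil _ _, hsrc, Finset.mem_insert_self W V, List.isChain_singleton W,
    fun u hu => by rw [List.mem_singleton.1 hu]; exact Finset.mem_insert_self W S⟩

/-- If `W` does not read the source and is kept (targets preceding `W`, `W ∉ S`), an open path to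
`V ∪ {W}` is an open path within `S` to `V` or to a parent of `W`. [cite: PolyanskiyWu2017,
Thm 5 (proof of the `perc` recursion)] -/
theorem hasOpenPath_insert_insert {W : Fin N} {S V : Finset (Fin N)} (hV : ∀ v ∈ V, v < W)
    (hsrc : G.src W = false) :
    G.HasOpenPath (insert W S) (insert W V) ↔ G.HasOpenPath S (V ∪ G.pa W) := by
  constructor
  · rintro ⟨l, hl, h1, h2, h3, h4⟩
    by_cases hlast : l.getLast hl = W
    · -- the path ends at `W`: drop the endpoint
      set l' := l.dropLast with hl'
      have hsplit : l' ++ [W] = l := by rw [hl', ← hlast]; exact List.dropLast_append_getLast hl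
      have hl'ne : l' ≠ [] := by
        intro h
        rw [h, List.nil_append] at hsplit
        subst hsplit
        rw [List.head_cons] at h1
        rw [hsrc] at h1
        exact Bool.false_ne_true h1
      rw [← hsplit, List.isChain_append] at h3
      obtain ⟨hc', -, hj⟩ := h3
      have hpa : l'.getLast hl'ne ∈ G.pa W :=
        hj _ (List.getLast?_eq_some_getLast hl'ne) W rfl
      refine ⟨l', hl'ne, ?_, Finset.mem_union_right V hpa, hc', fun u hu => ?_⟩
      · have hhead : l'.head hl'ne = l.head hl := by
          have h := congrArg List.head? hsplit
          rw [List.head?_append_of_ne_nil _ hl'ne, List.head?_eq_some_head hl'ne,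
            List.head?_eq_some_head hl] at h
          exact Option.some.inj h
        rw [hhead]; exact h1
      · have hlt : u < W := lt_of_le_of_lt (G.le_getLast_of_mem hl'ne hc' hu) (G.pa_lt W _ hpa)
        have hul : u ∈ l := by rw [← hsplit]; exact List.mem_append_left _ hu
        exact (Finset.mem_insert.1 (h4 u hul)).resolve_left (ne_of_lt hlt)
    · -- the path ends in `V`
      have hlV : l.getLast hl ∈ V := (Finset.mem_insert.1 h2).resolve_left hlast
      refine ⟨l, hl, h1, Finset.mem_union_left _ hlV, h3, fun u hu => ?_⟩
      have hlt : u < W := lt_of_le_of_lt (G.le_getLast_of_mem hl h3 hu) (hV _ hlV)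
      exact (Finset.mem_insert.1 (h4 u hu)).resolve_left (ne_of_lt hlt)
  · rintro ⟨l, hl, h1, h2, h3, h4⟩
    rcases Finset.mem_union.1 h2 with hv | hv
    · exact ⟨l, hl, h1, Finset.mem_insert_of_mem hv, h3,
        fun u hu => Finset.mem_insert_of_mem (h4 u hu)⟩
    · refine ⟨l ++ [W], by simp, ?_, ?_, ?_, fun u hu => ?_⟩
      · rwa [List.head_append_of_ne_nil]
      · rw [List.getLast_append_of_ne_nil _ (List.cons_ne_nil _ _), List.getLast_singleton]
        exact Finset.mem_insert_self W V
      · rw [List.isChain_append]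
        refine ⟨h3, List.isChain_singleton W, fun x hx y hy => ?_⟩
        rw [List.getLast?_eq_some_getLast hl, Option.mem_some_iff] at hx
        rw [List.head?_cons, Option.mem_some_iff] at hy
        rw [← hx, ← hy]; exact hv
      · rcases List.mem_append.1 hu with h | h
        · exact Finset.mem_insert_of_mem (h4 u h)
        · rw [List.mem_singleton.1 h]; exact Finset.mem_insert_self W S

/-- No path ends in the empty target set: `perc(∅) = 0`. [folklore] -/
theorem perc_empty (η : Fin N → ℝ) : G.perc η ∅ = 0 := by
  classical
  unfold perc
  refine Finset.sum_eq_zero fun S _ => if_neg ?_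
  rintro ⟨l, hl, -, h2, -⟩
  exact Finset.notMem_empty _ h2

/-- **The percolation recursion** (PW17, proof of Thm 5): for targets `V` preceding `W`,
`perc(V ∪ {W}) = (1-η_W) perc(V) + η_W perc(V ∪ pa(W))`, where `perc(V ∪ pa W) = 1` when the
source is a parent of `W` (condition on whether `W` is kept; the event `{W kept}` is independent
of the paths to targets preceding `W`). [cite: PolyanskiyWu2017, Thm 5 (proof, display after
(16))] -/
theorem perc_insert (η : Fin N → ℝ) (W : Fin N) (V : Finset (Fin N)) (hV : ∀ v ∈ V, v < W) :
    G.perc η (insert W V) = (1 - η W) * G.perc η V +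
      η W * (if G.src W = true then 1 else G.perc η (V ∪ G.pa W)) := by
  classical
  set U₀ : Finset (Fin N) := Finset.univ.erase W with hU₀
  have hWU₀ : W ∉ U₀ := by simp [hU₀]
  have huniv : (Finset.univ : Finset (Fin N)) = insert W U₀ := by simp [hU₀]
  -- the percolation weights on the other nodes
  set pw₀ : Finset (Fin N) → ℝ := fun S => (∏ u ∈ S, η u) * ∏ u ∈ U₀ \ S, (1 - η u) with hpw₀
  have w1 : ∀ S ∈ U₀.powerset, percWeight η S = (1 - η W) * pw₀ S := fun S hS => by
    have hWS : W ∉ S := fun h => hWU₀ (Finset.mem_powerset.1 hS h)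
    have hWUS : W ∉ U₀ \ S := fun h => hWU₀ (Finset.mem_sdiff.1 h).1
    rw [percWeight, univ_sdiff_eq_insert hWS, ← hU₀, Finset.prod_insert hWUS, hpw₀]
    ring
  have w2 : ∀ S ∈ U₀.powerset, percWeight η (insert W S) = η W * pw₀ S := fun S hS => by
    have hWS : W ∉ S := fun h => hWU₀ (Finset.mem_powerset.1 hS h)
    rw [percWeight, univ_sdiff_insert, ← hU₀, Finset.prod_insert hWS, hpw₀]
    ring
  have hsum1 : ∑ S ∈ U₀.powerset, pw₀ S = 1 := by
    have := Finset.prod_add (fun v => η v) (fun v => 1 - η v) U₀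
    simp only [add_sub_cancel, Finset.prod_const_one] at this
    rw [this]
  -- `perc` of targets preceding `W`, computed on the other nodes
  have reduce : ∀ V' : Finset (Fin N), (∀ v ∈ V', v < W) →
      G.perc η V' = ∑ S ∈ U₀.powerset, if G.HasOpenPath S V' then pw₀ S else 0 := by
    intro V' hV'
    unfold perc
    rw [huniv, Finset.sum_powerset_insert hWU₀, ← Finset.sum_add_distrib]
    refine Finset.sum_congr rfl fun S hS => ?_
    rw [w1 S hS, w2 S hS]
    simp only [G.hasOpenPath_insert_left hV']
    split_ifs <;> ring
  have hUW : ∀ u ∈ V ∪ G.pa W, u < W := fun u hu =>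
    (Finset.mem_union.1 hu).elim (hV u) (G.pa_lt W u)
  -- expand the left-hand side over `S ∌ W` / `S ∪ {W}`
  have lhs : G.perc η (insert W V) = ∑ S ∈ U₀.powerset,
      ((if G.HasOpenPath S (insert W V) then percWeight η S else 0) +
        if G.HasOpenPath (insert W S) (insert W V) then percWeight η (insert W S) else 0) := by
    unfold perc
    rw [huniv, Finset.sum_powerset_insert hWU₀, ← Finset.sum_add_distrib]
  rw [lhs]
  cases hs : G.src W
  · -- `W` does not read the source
    simp only [Bool.false_eq_true, if_false]
    rw [reduce V hV, reduce _ hUW, Finset.mul_sum, Finset.mul_sum, ← Finset.sum_add_distrib]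
    refine Finset.sum_congr rfl fun S hS => ?_
    have hWS : W ∉ S := fun h => hWU₀ (Finset.mem_powerset.1 hS h)
    rw [w1 S hS, w2 S hS]
    simp only [G.hasOpenPath_insert_right hWS, G.hasOpenPath_insert_insert hV hs]
    split_ifs <;> ring
  · -- `W` reads the source
    simp only [if_true, mul_one]
    rw [reduce V hV, Finset.mul_sum]
    calc _ = ∑ S ∈ U₀.powerset, ((1 - η W) * (if G.HasOpenPath S V then pw₀ S else 0) +
        η W * pw₀ S) := ?_
      _ = _ := by rw [Finset.sum_add_distrib, ← Finset.mul_sum, ← Finset.mul_sum, hsum1, mul_one]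
    refine Finset.sum_congr rfl fun S hS => ?_
    have hWS : W ∉ S := fun h => hWU₀ (Finset.mem_powerset.1 hS h)
    rw [w1 S hS, w2 S hS]
    simp only [G.hasOpenPath_insert_right hWS, G.hasOpenPath_insert_of_src hs, if_true]
    split_ifs <;> ring

end Perc

end BayesNet

/-! ### Theorem 5: induction on the maximal element of `V` -/

section Thm5

variable {N : ℕ} {A B : Type} [Fintype A] [Nonempty A] [MeasurableSpace A]
  [DiscreteMeasurableSpace A] [Fintype B] [MeasurableSpace B] [DiscreteMeasurableSpace B]
  (G : BayesNet N A B)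

omit [DiscreteMeasurableSpace A] [Fintype B] [DiscreteMeasurableSpace B] in
/-- Two probability laws on a one-point alphabet coincide, so `η_KL(P_{Y_∅|X}) = 0` in ratio
form. [folklore] -/
theorem klDiv_marginal_empty_comp (P Q : Measure B) [IsProbabilityMeasure P]
    [IsProbabilityMeasure Q] :
    klDiv (G.marginal ∅ ∘ₘ P) (G.marginal ∅ ∘ₘ Q) = 0 := by
  have : G.marginal ∅ ∘ₘ P = G.marginal ∅ ∘ₘ Q := by
    refine Measure.ext_of_singleton fun z => ?_
    have hz : ({z} : Set (↥(∅ : Finset (Fin N)) → A)) = Set.univ :=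
      Set.eq_univ_of_forall fun w => Subsingleton.elim w z
    rw [hz, measure_univ, measure_univ]
  rw [this, klDiv_self]

/-- **PW17 Theorem 5 by induction on the maximal element of `V`**: for every `k` and every
`V ⊆ {v < k}`, `η_KL(P_{Y_V|X}) ≤ perc(V)` with retention probabilities `η_v = η_KL(K_v)`.
[cite: PolyanskiyWu2017, Thm 5 (percolation bound, proof by induction)] -/
theorem etaKL_marginal_le_perc (k : ℕ) :
    ∀ V : Finset (Fin N), (∀ v ∈ V, v.val < k) →
      etaKL (G.marginal V) ≤
        ENNReal.ofReal (G.perc (fun v => (etaKL (G.kernel v)).toReal) V) := by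
  -- an empty source alphabet carries no probability law: the coefficient is `0`
  rcases isEmpty_or_nonempty B with hB | hB
  · intro V _
    refine etaKL_le_of_forall _ fun P Q hP hQ h0 htop => ?_
    exact absurd (BayesNet.nonempty_of_prob P) (not_nonempty_iff.2 hB)
  set η : Fin N → ℝ := fun v => (etaKL (G.kernel v)).toReal with hη_def
  have hle1 : ∀ v, etaKL (G.kernel v) ≤ 1 := fun v => etaKL_le_one _
  have hη : ∀ v, 0 ≤ η v ∧ η v ≤ 1 := fun v =>
    ⟨ENNReal.toReal_nonneg, ENNReal.toReal_le_of_le_ofReal zero_le_one (by simpa using hle1 v)⟩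
  have hηK : ∀ v, etaKL (G.kernel v) ≤ ENNReal.ofReal (η v) := fun v =>
    (ENNReal.ofReal_toReal (ne_top_of_le_ne_top ENNReal.one_ne_top (hle1 v))).ge
  induction k with
  | zero =>
    intro V hV
    have hVe : V = ∅ := Finset.eq_empty_of_forall_notMem fun v hv => Nat.not_lt_zero _ (hV v hv)
    subst hVe
    refine etaKL_le_of_forall _ fun P Q hP hQ h0 htop => ?_
    rw [klDiv_marginal_empty_comp, ENNReal.zero_div]
    exact bot_le
  | succ k ih =>
    intro V hV
    by_cases hk : ∃ W ∈ V, W.val = k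
    · obtain ⟨W, hWV, hWk⟩ := hk
      set V' := V.erase W with hV'
      have hV'W : ∀ v ∈ V', v < W := fun v hv => by
        have hne : v ≠ W := Finset.ne_of_mem_erase hv
        have hlt : v.val < k + 1 := hV v (Finset.mem_of_mem_erase hv)
        rw [Fin.lt_def, hWk]
        exact lt_of_le_of_ne (Nat.lt_succ_iff.1 hlt) fun h => hne (Fin.ext (h.trans hWk.symm))
      have hUW : ∀ u ∈ V' ∪ G.pa W, u < W := fun u hu =>
        (Finset.mem_union.1 hu).elim (hV'W u) (G.pa_lt W u)
      have ih1 := ih V' fun v hv => by have := hV'W v hv; rwa [Fin.lt_def, hWk] at this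
      have ih2 := ih (V' ∪ G.pa W) fun v hv => by have := hUW v hv; rwa [Fin.lt_def, hWk] at this
      rw [← Finset.insert_erase hWV, ← hV', G.perc_insert η W V' hV'W]
      refine etaKL_le_of_forall _ fun P Q hP hQ h0 htop => ?_
      rw [ENNReal.div_le_iff h0 htop]
      have hPQ : P ≪ Q := (klDiv_ne_top_iff.1 htop).1
      have b1 : klDiv (G.marginal V' ∘ₘ P) (G.marginal V' ∘ₘ Q) ≤
          ENNReal.ofReal (G.perc η V') * klDiv P Q :=
        (klDiv_comp_le_etaKL_mul _ P Q htop).trans (mul_le_mul' ih1 le_rfl)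
      cases hs : G.src W
      · -- `W` does not read the source
        have b2 : klDiv (G.marginal (V' ∪ G.pa W) ∘ₘ P) (G.marginal (V' ∪ G.pa W) ∘ₘ Q) ≤
            ENNReal.ofReal (G.perc η (V' ∪ G.pa W)) * klDiv P Q :=
          (klDiv_comp_le_etaKL_mul _ P Q htop).trans (mul_le_mul' ih2 le_rfl)
        have hrec := G.klDiv_marginal_insert_le_of_src_eq_false W V' hV'W hs P Q hPQ (hη W).1
          (hη W).2 (hηK W)
        simp only [Bool.false_eq_true, if_false]
        calc _ ≤ ENNReal.ofReal (1 - η W) * (ENNReal.ofReal (G.perc η V') * klDiv P Q) +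
            ENNReal.ofReal (η W) * (ENNReal.ofReal (G.perc η (V' ∪ G.pa W)) * klDiv P Q) :=
              hrec.trans (add_le_add (mul_le_mul' le_rfl b1) (mul_le_mul' le_rfl b2))
          _ = _ := by
            rw [← mul_assoc, ← mul_assoc, ← add_mul, ← ENNReal.ofReal_mul (sub_nonneg.2 (hη W).2),
              ← ENNReal.ofReal_mul (hη W).1, ← ENNReal.ofReal_add
                (mul_nonneg (sub_nonneg.2 (hη W).2) (BayesNet.perc_nonneg hη _))
                (mul_nonneg (hη W).1 (BayesNet.perc_nonneg hη _))]
      · -- `W` reads the source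
        have hrec := G.klDiv_marginal_insert_le W V' hV'W P Q hPQ (hη W).1 (hη W).2 (hηK W)
        rw [if_pos rfl, mul_one]
        calc _ ≤ ENNReal.ofReal (1 - η W) * (ENNReal.ofReal (G.perc η V') * klDiv P Q) +
            ENNReal.ofReal (η W) * klDiv P Q :=
              hrec.trans (add_le_add (mul_le_mul' le_rfl b1) le_rfl)
          _ = _ := by
            rw [← mul_assoc, ← add_mul, ← ENNReal.ofReal_mul (sub_nonneg.2 (hη W).2),
              ← ENNReal.ofReal_add (mul_nonneg (sub_nonneg.2 (hη W).2) (BayesNet.perc_nonneg hη _))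
                (hη W).1]
    · exact ih V fun v hv =>
        lt_of_le_of_ne (Nat.lt_succ_iff.1 (hV v hv)) fun h => hk ⟨v, hv, h⟩

end Thm5

/-- **Polyanskiy–Wu 2017, Theorem 5 (percolation of information) — DISCHARGED.**
`η_KL(P_{Y_V|X}) ≤ perc(V)` for every Bayesian network on a finite DAG with finite alphabets and
every target set `V`, with retention probabilities `η_v = η_KL(P_{Y_v | X, Y_{pa v}})`.
Proof as printed (induction on the maximal element of `V`, recursion (9) and the matching
recursion for `perc`), except that (9) is derived directly for divergences by two applications
of the chain rule and a fibrewise SDPI instead of through the mutual-information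
characterisation (13). [cite: PolyanskiyWu2017, Thm 5] -/
theorem PolyanskiyWu2017_thm5_holds : PolyanskiyWu2017_thm5 := by
  intro N A B _ _ _ _ _ _ _ G V
  exact etaKL_marginal_le_perc G N V fun v _ => v.2

end Literature.Probability.Entropy
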